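import Literature.Computability.Complexity.FoldBricks
import Literature.Computability.Complexity.ListFoldBricks
import Literature.Computability.MetaComplexity.FregeProofs
import HarnessLib

/-!
# The Cook–Reckhow translation between Frege systems is polynomial-time computable

Topic `Literature/Computability/MetaComplexity` (proof complexity), the machine content of
S. A. Cook, R. A. Reckhow, *The relative efficiency of propositional proof systems*, J. Symbolic
Logic 44 (1979) 36–50, **Theorem 2.3**: "For any two Frege systems `𝓕₁` and `𝓕₂` over `κ` there
is a function `f` in `𝓛` and constant `c` such that for all formulas `A₁, …, Aₙ, B` and
derivations `π`, if `A₁, …, Aₙ ⊢^π_{𝓕₁} B` then `A₁, …, Aₙ ⊢^{f(π)}_{𝓕₂} B`, and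
`λ(f(π)) ≤ c λ(π)` and `ρ(f(π)) ≤ c ρ(π)`" (`𝓛` = the polynomial-time computable functions,
§1), whose proof (p. 40) is: "For each rule `R = (C₁, …, C_m)/D` in `𝓕₁`, let `π_R` be a
derivation of `D` from `C₁, …, C_m` in `𝓕₂`. … if `B_i` follows from earlier `B_j`'s by the
`𝓕₁`-rule `R_i` and substitution `σ_i`, simply replace `B_i` by the derivation `σ_i(π_{R_i})`",
together with **Lemma 2.5** (derivations are closed under substitution) and **Corollary 2.4**
("Any two Frege systems over `κ` p-simulate each other"). The paper takes `f ∈ 𝓛` for granted;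
this file supplies it for the tree's Frege systems (`Frege.lean`: rules as data over
`PropForm ℕ`, p-simulation `FregeSystem.PSimulates` w.r.t. the list code
`encodingPropForm.listBool` on Mathlib's `TM2` model), in the ALGEBRA OF `FP` STRING FUNCTIONS of
the tree (`comp_mem_FP`, `fanoutFn`, `iteFn`, `eqPairFn`, `appendFn`, the record projections
`nthF`/`sndPow` of `BrickAlgebra.lean`, clocked iteration `iterate_mem_FP_of_growth`, the coin
truncation `truncSndFn`): no machine is written.

## The translation (`translForms`, `translFn`)

Given a list of rules `rs` (those of the simulated system) and a table `D` assigning to each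
rule an arbitrary list of formulas (in the application: a derivation of its conclusion from its
premises in the simulating system), the line `θ` of a sequence, after the earlier lines `Es`, is
replaced by the block `σ'(D r)` for the FIRST rule `r ∈ rs` and tuple `ℓs` of earlier lines
(lexicographic in the order of `Es`, one entry per premise) such that `(θ, ℓs)` is an instance
of `(r.conclusion, r.premises)`; `σ'` is the matching substitution read off the skeleton
(`substOf`: a pattern variable goes to the subformula at its first occurrence, every other
variable to `⊤`, cf. `ProofComplexityProofs.lean`, `exists_block`); no block if nothing matches
(`lineForms`, `translForms`). This file proves that the translation is POLYNOMIAL-TIME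
(`polyTimeComputable_translForms`): the string function `translFn D rs ∈ FP` computes it on
code words (`translFn_encode`); and it records what a block is (`lineForms_cases`: `σ(D r)` for a
rule `r ∈ rs` and a substitution `σ` under which `θ` is the conclusion and the premises are
among `Es`, or empty) and that a block is found whenever `θ` is `rs`-inferred from `Es`
(`lineForms_of_inferred`, whose hypothesis is literally `FregeSystem.IsInferred`).

What is NOT proved here: that `translForms D F₂.rules π` is an `F₁`-proof when `π` is an
`F₂`-proof and `D` tabulates `F₁`-derivations of the rules of `F₂` — the derivation-theoretic
half of Thm. 2.3, which with `polyTimeComputable_translForms` gives Cor. 2.4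
(`FregeSystem.PSimulates`, hence the named fact `frege_pSimulates` of `ProofComplexity.lean`);
that half belongs with the Frege-system lemmas of `ProofComplexityProofs.lean` and is the
planned follow-up there.

## Architecture (three layers)

* Layer S (strings): every stage is an explicit composition of `FP` bricks, so membership in
  `FP` is by construction (`…_mem_FP`). Loops over coded lists are the tree's list-fold round
  `Brick.foldRound` (`ListFoldBricks.lean`: record `⟨x, ⟨rest, st⟩⟩`, growth contract
  `Brick.FoldGrowth`, `length_foldRound_le`, `iterate_foldRound`), clocked here as
  `feLoop p G = (foldRound G)^[p |x|]` — a thin local wrapper kept because the loops of this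
  file start from their own records and need round counts `p = X` and `p = M · X`, whereas
  the packaged `Brick.foldFn` fixes both; results that could be long on malformed words are
  clipped by the tree's `Brick.clipF` (`FoldBricks.lean`); the splitter's scan loop is a plain
  `iterate_mem_FP_of_growth`.
* Layer M (bit streams): each brick has an `_apply` lemma giving its value on EVERY word in terms
  of the record projections (`scanRound_apply`, `skelS_apply`, `matchS_apply`, `seBody_rec`,
  …), so that iterates commute with the mirror functions (`scanM`, `skelM`) and growth bounds
  hold on malformed words too; results that could be long on malformed words are capped
  linearly in the input (`Brick.clipF`, a no-op on genuine data by `length_encList_block_le`).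
* Layer P (formulas): on genuine codes the mirrors compute the intended objects: the scanner
  reads one subformula of a prefix code (`scanM_iterate_code`, `splitFn_code`), skeleton
  decomposition decides `fits` and returns the bindings (`skelM_code`), the code-level
  consistency test decides `Consistent` (`consM_consPairs_iff`), matching is sound and complete
  for rule instances (`matchOkM_sound`, `matchOkM_complete`, via the conjunction chain
  `rulePat r = r.conclusion ∧ r.premises…`), the emitted block is the list of code words of
  `σ'(D r)` (`blockM_eq_encList`), the search finds the first matching tuple (`searchS_spec`,
  `tupleSearch_sound/complete`), the cascade the first rule (`cascS_spec`), and the outer loop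
  accumulates `translForms` (`foldl_outBody`, `translS_encode`).

Stages: §1 scanner/splitter of the prefix code `PropForm.code` (tokens `00·⟨bin n, []⟩`, `01b`,
`10`, `11b`); §2 skeletons, bindings, consistency, matching substitution; §3 skeleton
decomposition as a string function; §4 consistency test and emission of substituted lines
(unary size headers by re-scanning the emitted code); §5 the matcher of one rule on a candidate
stream; §6 the clocked list-fold loop `feLoop`; §7 the search over tuples and the cascade over rules; §8 the
outer loop and packaging (`Encoding.listBool`); §9 specification at the level of formulas and
the size bound; §10 `translS_encode`, `polyTimeComputable_translForms`.

## References

* S. A. Cook, R. A. Reckhow, *The relative efficiency of propositional proof systems*,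
  J. Symbolic Logic 44 (1979) 36–50: §1 (the class `𝓛`, Def. 1.5), §2, Def. 2.1 (substitution,
  Frege rule), Thm. 2.3 and its proof (p. 40), Cor. 2.4, Lemma 2.5.
* J. Krajíček, *Bounded arithmetic, propositional logic, and complexity theory*, CUP 1995,
  p. 49, Thm. 4.4.13 (Reckhow's theorem), Def. 4.4.1–4.4.2.
* S. Arora, B. Barak, *Computational Complexity: A Modern Approach*, CUP 2009, §0.1 (codes),
  §1.3 (closure of polynomial time under composition and bounded loops), §1.4.1 (clocked
  simulation) — for the brick algebra (`BrickAlgebra.lean`, `ListFoldBricks.lean`,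
  `FoldBricks.lean`).
-/

namespace Literature.Computability.MetaComplexity

open _root_.Computability Literature.Computability.Complexity Literature.Computability.Complexity.Brick
open Literature.Computability.Complexity.HashBricks (headBitFn headBitFn_apply headBitFn_mem_FP)

namespace FregeTransl

/-! ### Layer M: the token scanner on bit streams -/

/-- Scanner states `(acc, w, pend, siz)`: the tokens moved so far, the unread stream, the number
of subformulas still to be read (unary) and the number of tokens moved (unary). [folklore] -/
abbrev ScanSt : Type := List Bool × List Bool × List Bool × List Bool

/-- One scanner step: if `pend` is empty, idle; otherwise move the first token of `w`
(`00·⟨bin n, []⟩` variable, `01b` constant, `10` negation, `11b` binary connective) to the end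
of `acc`, update the number of pending subformulas (`-1`, `-1`, `0`, `+1`) and count the token.
Total on all bit streams (bits beyond the end of `w` read as `0`). [folklore] -/
def scanM (t : ScanSt) : ScanSt :=
  if t.2.2.1 = [] then t else
  if t.2.1.headD false then
    if t.2.1.tail.headD false then
      (t.1 ++ [true, true, t.2.1.tail.tail.headD false], t.2.1.tail.tail.tail, true :: t.2.2.1,
        true :: t.2.2.2)
    else (t.1 ++ [true, false], t.2.1.tail.tail, t.2.2.1, true :: t.2.2.2)
  else
    if t.2.1.tail.headD false then
      (t.1 ++ [false, true, t.2.1.tail.tail.headD false], t.2.1.tail.tail.tail, t.2.2.1.tail,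
        true :: t.2.2.2)
    else
      (t.1 ++ (false :: false :: boolPair (boolUnpair t.2.1.tail.tail).1 []),
        (boolUnpair t.2.1.tail.tail).2, t.2.2.1.tail, true :: t.2.2.2)

/-- An idle scanner stays idle. [folklore] -/
theorem scanM_of_nil (acc w siz : List Bool) : scanM (acc, w, [], siz) = (acc, w, [], siz) := by
  simp [scanM]

/-- Hence all its iterates. [folklore] -/
theorem scanM_iterate_of_nil (acc w siz : List Bool) (k : ℕ) :
    scanM^[k] (acc, w, [], siz) = (acc, w, [], siz) :=
  Function.iterate_fixed (scanM_of_nil acc w siz) k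

/-- Merging unary blocks. [folklore] -/
theorem replicate_true_append (a b : ℕ) (s : List Bool) :
    List.replicate a true ++ (List.replicate b true ++ s) = List.replicate (a + b) true ++ s := by
  rw [← List.append_assoc, ← List.replicate_add]

/-- Merging a unary digit into a block. [folklore] -/
theorem true_cons_replicate (a : ℕ) (s : List Bool) :
    true :: (List.replicate a true ++ s) = List.replicate (a + 1) true ++ s := by
  rw [List.replicate_succ]; rfl

/-- Merging a trailing unary digit into a block. [folklore] -/
theorem replicate_true_append_true_cons (a : ℕ) (s : List Bool) :
    List.replicate a true ++ true :: s = List.replicate (a + 1) true ++ s := by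
  rw [List.replicate_succ', List.append_assoc]; rfl

/-- `⟨a, []⟩ ++ r = ⟨a, r⟩`. [folklore] -/
theorem boolPair_nil_append (a r : List Bool) : boolPair a [] ++ r = boolPair a r := by
  simp [boolPair]

/-- **The scanner reads one subformula**: started on `code φ ++ rest` with a pending count
`p + 1`, after `k ≥ |φ|` steps it has moved exactly `code φ`, counted `|φ|` tokens, and the
pending count is `p`. [folklore] -/
theorem scanM_iterate_code (φ : PropForm ℕ) :
    ∀ (acc rest pend siz : List Bool) (k : ℕ), φ.size ≤ k →
      scanM^[k] (acc, φ.code ++ rest, true :: pend, siz) =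
        scanM^[k - φ.size] (acc ++ φ.code, rest, pend, List.replicate φ.size true ++ siz) := by
  induction φ with
  | var n =>
    intro acc rest pend siz k hk
    obtain ⟨k, rfl⟩ := Nat.exists_eq_add_of_le' hk
    rw [Function.iterate_add_apply]
    simp [PropForm.code, PropForm.size, scanM, boolPair_nil_append]
  | const b =>
    intro acc rest pend siz k hk
    obtain ⟨k, rfl⟩ := Nat.exists_eq_add_of_le' hk
    rw [Function.iterate_add_apply]
    simp [PropForm.code, PropForm.size, scanM]
  | neg φ ih =>
    intro acc rest pend siz k hk
    simp only [PropForm.size] at hk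
    obtain ⟨k, rfl⟩ := Nat.exists_eq_add_of_le' hk
    rw [show k + (φ.size + 1) = (k + φ.size) + 1 by ring, Function.iterate_succ_apply]
    have h1 : scanM (acc, (PropForm.neg φ).code ++ rest, true :: pend, siz) =
        (acc ++ [true, false], φ.code ++ rest, true :: pend, true :: siz) := by
      simp [PropForm.code, scanM]
    rw [h1, ih _ _ _ _ _ (Nat.le_add_left _ _)]
    congr 1
    · simp [PropForm.size]
    · simp [PropForm.code, PropForm.size, List.replicate_succ', List.append_assoc]
  | conj φ ψ ihφ ihψ =>
    intro acc rest pend siz k hk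
    simp only [PropForm.size] at hk
    obtain ⟨k, rfl⟩ := Nat.exists_eq_add_of_le' hk
    rw [show k + (φ.size + ψ.size + 1) = (k + ψ.size + φ.size) + 1 by ring,
      Function.iterate_succ_apply]
    have h1 : scanM (acc, (PropForm.conj φ ψ).code ++ rest, true :: pend, siz) =
        (acc ++ [true, true, false], φ.code ++ (ψ.code ++ rest), true :: true :: pend,
          true :: siz) := by
      simp [PropForm.code, scanM]
    rw [h1, ihφ _ _ _ _ _ (Nat.le_add_left _ _), Nat.add_sub_cancel,
      ihψ _ _ _ _ _ (Nat.le_add_left _ _)]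
    congr 1
    · simp [PropForm.size]; omega
    · simp only [PropForm.code, PropForm.size, List.append_assoc, List.cons_append,
        List.nil_append, replicate_true_append, replicate_true_append_true_cons,
        show ψ.size + (φ.size + 1) = φ.size + ψ.size + 1 by omega]
  | disj φ ψ ihφ ihψ =>
    intro acc rest pend siz k hk
    simp only [PropForm.size] at hk
    obtain ⟨k, rfl⟩ := Nat.exists_eq_add_of_le' hk
    rw [show k + (φ.size + ψ.size + 1) = (k + ψ.size + φ.size) + 1 by ring,
      Function.iterate_succ_apply]
    have h1 : scanM (acc, (PropForm.disj φ ψ).code ++ rest, true :: pend, siz) =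
        (acc ++ [true, true, true], φ.code ++ (ψ.code ++ rest), true :: true :: pend,
          true :: siz) := by
      simp [PropForm.code, scanM]
    rw [h1, ihφ _ _ _ _ _ (Nat.le_add_left _ _), Nat.add_sub_cancel,
      ihψ _ _ _ _ _ (Nat.le_add_left _ _)]
    congr 1
    · simp [PropForm.size]; omega
    · simp only [PropForm.code, PropForm.size, List.append_assoc, List.cons_append,
        List.nil_append, replicate_true_append, replicate_true_append_true_cons,
        show ψ.size + (φ.size + 1) = φ.size + ψ.size + 1 by omega]

/-- The encoding length of a scanner state grows by at most `9` per step. [folklore] -/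
theorem length_encSt_scanM_le (t : ScanSt) :
    2 * (scanM t).1.length + 2 * (scanM t).2.1.length + 2 * (scanM t).2.2.1.length +
        (scanM t).2.2.2.length ≤
      2 * t.1.length + 2 * t.2.1.length + 2 * t.2.2.1.length + t.2.2.2.length + 9 := by
  obtain ⟨acc, w, pend, siz⟩ := t
  unfold scanM
  simp only
  have ht : ∀ l : List Bool, l.tail.length ≤ l.length := fun l => by simp
  have h1 := ht w
  have h2 := ht w.tail
  have h3 := ht w.tail.tail
  have h4 := ht pend
  have h5 := length_boolUnpair_parts_le w.tail.tail
  split_ifs <;> simp <;> omega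

/-! ### Layer S: the scanner as a polynomial-time string function -/

/-- The record `⟨x, ⟨acc, ⟨w, ⟨pend, siz⟩⟩⟩⟩` of a ruler `x` and a scanner state. [folklore] -/
def encSt (x : List Bool) (t : ScanSt) : List Bool :=
  boolPair x (boolPair t.1 (boolPair t.2.1 (boolPair t.2.2.1 t.2.2.2)))

/-- The unread stream after dropping one bit. [folklore] -/
def sW1 : List Bool → List Bool := List.tail ∘ nthF 2
/-- The unread stream after dropping two bits. [folklore] -/
def sW2 : List Bool → List Bool := List.tail ∘ sW1
/-- The unread stream after dropping three bits. [folklore] -/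
def sW3 : List Bool → List Bool := List.tail ∘ sW2

/-- Branch of `scanRound`: a binary connective token `11b`. [folklore] -/
noncomputable def sBin : List Bool → List Bool :=
  fanoutFn (appendFn ∘ fanoutFn (nthF 1) (List.cons true ∘ List.cons true ∘ headBitFn ∘ sW2))
    (fanoutFn sW3 (fanoutFn (List.cons true ∘ nthF 3) (List.cons true ∘ sndPow 3)))
/-- Branch of `scanRound`: a negation token `10`. [folklore] -/
noncomputable def sNeg : List Bool → List Bool :=
  fanoutFn (appendFn ∘ fanoutFn (nthF 1) (fun _ => [true, false]))
    (fanoutFn sW2 (fanoutFn (nthF 3) (List.cons true ∘ sndPow 3)))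
/-- Branch of `scanRound`: a constant token `01b`. [folklore] -/
noncomputable def sConst : List Bool → List Bool :=
  fanoutFn (appendFn ∘ fanoutFn (nthF 1) (List.cons false ∘ List.cons true ∘ headBitFn ∘ sW2))
    (fanoutFn sW3 (fanoutFn (List.tail ∘ nthF 3) (List.cons true ∘ sndPow 3)))
/-- Branch of `scanRound`: a variable token `00·⟨bin n, []⟩`. [folklore] -/
noncomputable def sVar : List Bool → List Bool :=
  fanoutFn (appendFn ∘ fanoutFn (nthF 1)
      (List.cons false ∘ List.cons false ∘ fanoutFn (fstF ∘ sW2) (fun _ => [])))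
    (fanoutFn (sndF ∘ sW2) (fanoutFn (List.tail ∘ nthF 3) (List.cons true ∘ sndPow 3)))
/-- Branch of `scanRound`: idle (the state rebuilt from its fields). [folklore] -/
noncomputable def sIdle : List Bool → List Bool :=
  fanoutFn (nthF 1) (fanoutFn (nthF 2) (fanoutFn (nthF 3) (sndPow 3)))

/-- **One round of the scanner** on records `⟨x, state⟩` (the ruler `x` is kept): dispatch on
"`pend` empty", then on the first two bits of the unread stream. [folklore] -/
noncomputable def scanRound : List Bool → List Bool :=
  fanoutFn fstF (iteFn (isNilFn ∘ nthF 3) sIdle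
    (iteFn (headBitFn ∘ nthF 2) (iteFn (headBitFn ∘ sW1) sBin sNeg)
      (iteFn (headBitFn ∘ sW1) sConst sVar)))

/-- **`scanRound` computes `scanM`** on the fields of any word. [folklore] -/
theorem scanRound_apply (z : List Bool) :
    scanRound z = encSt (fstF z) (scanM (nthF 1 z, nthF 2 z, nthF 3 z, sndPow 3 z)) := by
  have hc0 : (isNilFn ∘ nthF 3) z = [decide (nthF 3 z = [])] := rfl
  have hc1 : (headBitFn ∘ nthF 2) z = [(nthF 2 z).headD false] := headBitFn_apply _
  have hc2 : (headBitFn ∘ sW1) z = [(nthF 2 z).tail.headD false] := headBitFn_apply _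
  unfold scanRound scanM
  rw [fanoutFn_apply, iteFn_apply hc0]
  by_cases hp : nthF 3 z = []
  · simp [hp, sIdle, encSt]
  · rw [decide_eq_false hp, iteFn_apply hc1]
    simp only [hp, if_false, Bool.false_eq_true]
    cases h0 : (nthF 2 z).headD false
    · simp only [if_false, Bool.false_eq_true]
      rw [iteFn_apply hc2]
      cases h1 : (nthF 2 z).tail.headD false
      · simp [sVar, sW2, sW1, encSt, fstF, sndF]
      · simp [sConst, sW3, sW2, sW1, encSt]
    · simp only [if_true]
      rw [iteFn_apply hc2]
      cases h1 : (nthF 2 z).tail.headD false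
      · simp [sNeg, sW2, sW1, encSt]
      · simp [sBin, sW3, sW2, sW1, encSt]

/-- `scanRound` on a record. [folklore] -/
theorem scanRound_encSt (x : List Bool) (t : ScanSt) : scanRound (encSt x t) = encSt x (scanM t) := by
  rw [scanRound_apply]; simp [encSt]

/-- Iterated rounds on a record. [folklore] -/
theorem scanRound_iterate_encSt (x : List Bool) (n : ℕ) (t : ScanSt) :
    scanRound^[n] (encSt x t) = encSt x (scanM^[n] t) := by
  induction n generalizing t with
  | zero => rfl
  | succ n ih => rw [Function.iterate_succ_apply, scanRound_encSt, ih, Function.iterate_succ_apply]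

/-- `scanRound` keeps the ruler, on every word. [folklore] -/
theorem fstF_scanRound (z : List Bool) : fstF (scanRound z) = fstF z := by
  rw [scanRound_apply]; simp [encSt]

/-- **Additive growth of a round** (on every word): `|scanRound z| ≤ |z| + 17`. [folklore] -/
theorem length_scanRound_le (z : List Bool) : (scanRound z).length ≤ z.length + 17 := by
  rw [scanRound_apply]
  have h := length_encSt_scanM_le (nthF 1 z, nthF 2 z, nthF 3 z, sndPow 3 z)
  have h0 := length_fstF_sndF_le z
  have h1 : 2 * (nthF 1 z).length + (sndPow 1 z).length ≤ (sndF z).length := by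
    simpa using length_nthF_succ_add_sndPow_succ_le 0 z
  have h2 : 2 * (nthF 2 z).length + (sndPow 2 z).length ≤ (sndPow 1 z).length := by
    simpa using length_nthF_succ_add_sndPow_succ_le 1 z
  have h3 : 2 * (nthF 3 z).length + (sndPow 3 z).length ≤ (sndPow 2 z).length := by
    simpa using length_nthF_succ_add_sndPow_succ_le 2 z
  simp only [encSt, length_boolPair] at h ⊢
  omega

/-- `sW1 ∈ FP`. [folklore] -/
theorem sW1_mem_FP : sW1 ∈ FP := comp_mem_FP PRelSigma.tail_mem_FP (nthF_mem_FP 2)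
/-- `sW2 ∈ FP`. [folklore] -/
theorem sW2_mem_FP : sW2 ∈ FP := comp_mem_FP PRelSigma.tail_mem_FP sW1_mem_FP
/-- `sW3 ∈ FP`. [folklore] -/
theorem sW3_mem_FP : sW3 ∈ FP := comp_mem_FP PRelSigma.tail_mem_FP sW2_mem_FP

/-- `scanRound ∈ FP`. [folklore] -/
theorem scanRound_mem_FP : scanRound ∈ FP := by
  have hcons : ∀ b, (List.cons b : List Bool → List Bool) ∈ FP := cons_mem_FP
  have htl : (List.tail : List Bool → List Bool) ∈ FP := PRelSigma.tail_mem_FP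
  have hb2 : (List.cons true ∘ List.cons true ∘ headBitFn ∘ sW2) ∈ FP :=
    comp_mem_FP (hcons _) (comp_mem_FP (hcons _) (comp_mem_FP headBitFn_mem_FP sW2_mem_FP))
  have hb2' : (List.cons false ∘ List.cons true ∘ headBitFn ∘ sW2) ∈ FP :=
    comp_mem_FP (hcons _) (comp_mem_FP (hcons _) (comp_mem_FP headBitFn_mem_FP sW2_mem_FP))
  have hBin : sBin ∈ FP :=
    fanoutFn_mem_FP (comp_mem_FP appendFn_mem_FP (fanoutFn_mem_FP (nthF_mem_FP 1) hb2))
      (fanoutFn_mem_FP sW3_mem_FP (fanoutFn_mem_FP (comp_mem_FP (hcons _) (nthF_mem_FP 3))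
        (comp_mem_FP (hcons _) (sndPow_mem_FP 3))))
  have hNeg : sNeg ∈ FP :=
    fanoutFn_mem_FP (comp_mem_FP appendFn_mem_FP (fanoutFn_mem_FP (nthF_mem_FP 1) (const_mem_FP _)))
      (fanoutFn_mem_FP sW2_mem_FP (fanoutFn_mem_FP (nthF_mem_FP 3)
        (comp_mem_FP (hcons _) (sndPow_mem_FP 3))))
  have hConst : sConst ∈ FP :=
    fanoutFn_mem_FP (comp_mem_FP appendFn_mem_FP (fanoutFn_mem_FP (nthF_mem_FP 1) hb2'))
      (fanoutFn_mem_FP sW3_mem_FP (fanoutFn_mem_FP (comp_mem_FP htl (nthF_mem_FP 3))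
        (comp_mem_FP (hcons _) (sndPow_mem_FP 3))))
  have hVar : sVar ∈ FP :=
    fanoutFn_mem_FP (comp_mem_FP appendFn_mem_FP (fanoutFn_mem_FP (nthF_mem_FP 1)
        (comp_mem_FP (hcons _) (comp_mem_FP (hcons _)
          (fanoutFn_mem_FP (comp_mem_FP fstF_mem_FP sW2_mem_FP) (const_mem_FP _))))))
      (fanoutFn_mem_FP (comp_mem_FP sndF_mem_FP sW2_mem_FP)
        (fanoutFn_mem_FP (comp_mem_FP htl (nthF_mem_FP 3)) (comp_mem_FP (hcons _) (sndPow_mem_FP 3))))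
  have hIdle : sIdle ∈ FP :=
    fanoutFn_mem_FP (nthF_mem_FP 1) (fanoutFn_mem_FP (nthF_mem_FP 2)
      (fanoutFn_mem_FP (nthF_mem_FP 3) (sndPow_mem_FP 3)))
  exact fanoutFn_mem_FP fstF_mem_FP (iteFn_mem_FP (comp_mem_FP isNilFn_mem_FP (nthF_mem_FP 3))
    hIdle (iteFn_mem_FP (comp_mem_FP headBitFn_mem_FP (nthF_mem_FP 2))
      (iteFn_mem_FP (comp_mem_FP headBitFn_mem_FP sW1_mem_FP) hBin hNeg)
      (iteFn_mem_FP (comp_mem_FP headBitFn_mem_FP sW1_mem_FP) hConst hVar)))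

/-- The clocked scanner loop: `|x|` rounds. [folklore] -/
noncomputable def scanLoop : List Bool → List Bool :=
  fun z => scanRound^[(Polynomial.X : Polynomial ℕ).eval (boolUnpair z).1.length] z

/-- `scanLoop ∈ FP` (clocked iteration with additive growth). [folklore] -/
theorem scanLoop_mem_FP : scanLoop ∈ FP :=
  iterate_mem_FP_of_growth scanRound_mem_FP 17 fstF_scanRound
    (fun w => (length_scanRound_le w).trans (by nlinarith [Nat.zero_le (boolUnpair w).1.length]))
    Polynomial.X

/-- The initial record of the splitter on a stream `w`: ruler `w`, state `([], w, [1], [])`.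
[folklore] -/
noncomputable def splitInit : List Bool → List Bool :=
  fanoutFn id (fanoutFn (fun _ => []) (fanoutFn id (fanoutFn (fun _ => [true]) (fun _ => []))))

/-- The output record `⟨acc, ⟨siz, rest⟩⟩` of the splitter. [folklore] -/
noncomputable def splitOut : List Bool → List Bool :=
  fanoutFn (nthF 1) (fanoutFn (sndPow 3) (nthF 2))

/-- **The splitter** `splitFn`: on a stream starting with the code of a formula `φ`, the record
`⟨code φ, ⟨1^{|φ|}, rest⟩⟩` of that code, its size in unary, and the unread rest
(`splitFn_code`). [folklore] -/
noncomputable def splitFn : List Bool → List Bool := splitOut ∘ scanLoop ∘ splitInit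

/-- The splitter as an iterate of `scanM`, on every word. [folklore] -/
theorem splitFn_apply (w : List Bool) :
    splitFn w = boolPair (scanM^[w.length] ([], w, [true], [])).1
      (boolPair (scanM^[w.length] ([], w, [true], [])).2.2.2
        (scanM^[w.length] ([], w, [true], [])).2.1) := by
  have hi : splitInit w = encSt w ([], w, [true], []) := by simp [splitInit, encSt]
  simp only [splitFn, Function.comp_apply, scanLoop, hi]
  rw [show (boolUnpair (encSt w ([], w, [true], []))).1 = w by simp [encSt], Polynomial.eval_X,
    scanRound_iterate_encSt]
  simp [splitOut, encSt]

/-- **`splitFn (code φ ++ rest) = ⟨code φ, ⟨1^{|φ|}, rest⟩⟩`.** [folklore] -/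
theorem splitFn_code (φ : PropForm ℕ) (rest : List Bool) :
    splitFn (φ.code ++ rest) =
      boolPair φ.code (boolPair (List.replicate φ.size true) rest) := by
  rw [splitFn_apply]
  have hk : φ.size ≤ (φ.code ++ rest).length :=
    φ.size_le_length_code.trans (by simp)
  rw [scanM_iterate_code φ [] rest [] [] _ hk, scanM_iterate_of_nil]
  simp

/-- **`splitFn ∈ FP`.** [folklore] -/
theorem splitFn_mem_FP : splitFn ∈ FP :=
  comp_mem_FP (fanoutFn_mem_FP (nthF_mem_FP 1) (fanoutFn_mem_FP (sndPow_mem_FP 3) (nthF_mem_FP 2)))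
    (comp_mem_FP scanLoop_mem_FP (fanoutFn_mem_FP OracleCompose.id_mem_FP
      (fanoutFn_mem_FP (const_mem_FP _) (fanoutFn_mem_FP OracleCompose.id_mem_FP
        (fanoutFn_mem_FP (const_mem_FP _) (const_mem_FP _))))))


/-! ### Layer P: skeletons, bindings, variable sequences -/

/-- `fits p θ`: the formula `θ` has the skeleton of the pattern `p` (every node of `p` other than
a variable is matched by the same node of `θ`). [Cook–Reckhow 1979, §2.1 (substitution
instances)] [folklore] -/
def fits : PropForm ℕ → PropForm ℕ → Bool
  | .var _, _ => true
  | .const b, θ => decide (θ = .const b)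
  | .neg q, .neg θ => fits q θ
  | .neg _, _ => false
  | .conj q₁ q₂, .conj θ₁ θ₂ => fits q₁ θ₁ && fits q₂ θ₂
  | .conj _ _, _ => false
  | .disj q₁ q₂, .disj θ₁ θ₂ => fits q₁ θ₁ && fits q₂ θ₂
  | .disj _ _, _ => false

/-- `binds p θ`: the subformulas of `θ` at the variable positions of the pattern `p`, in
preorder (meaningful when `fits p θ`). [folklore] -/
def binds : PropForm ℕ → PropForm ℕ → List (PropForm ℕ)
  | .var _, θ => [θ]
  | .const _, _ => []
  | .neg q, .neg θ => binds q θ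
  | .neg _, _ => []
  | .conj q₁ q₂, .conj θ₁ θ₂ => binds q₁ θ₁ ++ binds q₂ θ₂
  | .conj _ _, _ => []
  | .disj q₁ q₂, .disj θ₁ θ₂ => binds q₁ θ₁ ++ binds q₂ θ₂
  | .disj _ _, _ => []

/-- `varSeq p`: the variable occurrences of `p` in preorder. [folklore] -/
def varSeq : PropForm ℕ → List ℕ
  | .var x => [x]
  | .const _ => []
  | .neg q => varSeq q
  | .conj q₁ q₂ => varSeq q₁ ++ varSeq q₂
  | .disj q₁ q₂ => varSeq q₁ ++ varSeq q₂

/-- A substitution instance of `p` fits `p`, with bindings the values at the variable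
occurrences. [Cook–Reckhow 1979, §2.1] [folklore] -/
theorem fits_subst (p : PropForm ℕ) (σ : ℕ → PropForm ℕ) :
    fits p (p.subst σ) = true ∧ binds p (p.subst σ) = (varSeq p).map σ := by
  induction p with
  | var x => simp [fits, binds, varSeq, PropForm.subst]
  | const b => simp [fits, binds, varSeq, PropForm.subst]
  | neg q ih => simpa [fits, binds, varSeq, PropForm.subst] using ih
  | conj q₁ q₂ ih₁ ih₂ => simp [fits, binds, varSeq, PropForm.subst, ih₁, ih₂]
  | disj q₁ q₂ ih₁ ih₂ => simp [fits, binds, varSeq, PropForm.subst, ih₁, ih₂]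

/-- A fitting formula has one binding per variable occurrence of the pattern. [folklore] -/
theorem length_binds : ∀ (p θ : PropForm ℕ), fits p θ = true → (binds p θ).length = (varSeq p).length
  | .var _, θ, _ => rfl
  | .const _, θ, _ => rfl
  | .neg q, θ, h => by
    cases θ <;> simp [fits] at h
    simpa [binds, varSeq] using length_binds q _ h
  | .conj q₁ q₂, θ, h => by
    cases θ <;> simp [fits] at h
    simp [binds, varSeq, length_binds q₁ _ h.1, length_binds q₂ _ h.2]
  | .disj q₁ q₂, θ, h => by
    cases θ <;> simp [fits] at h
    simp [binds, varSeq, length_binds q₁ _ h.1, length_binds q₂ _ h.2]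

/-- Conversely, a fitting formula whose bindings are the values of `σ` along `varSeq p` is the
instance `p σ`. [folklore] -/
theorem subst_eq_of_fits (σ : ℕ → PropForm ℕ) :
    ∀ (p θ : PropForm ℕ), fits p θ = true → binds p θ = (varSeq p).map σ → p.subst σ = θ
  | .var x, θ, _, h => by simpa [varSeq, binds, PropForm.subst, eq_comm] using h
  | .const b, θ, h, _ => by simpa [fits, PropForm.subst, eq_comm] using h
  | .neg q, θ, h, hb => by
    cases θ <;> simp [fits] at h
    simp only [varSeq, binds] at hb
    simp [PropForm.subst, subst_eq_of_fits σ q _ h hb]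
  | .conj q₁ q₂, θ, h, hb => by
    cases θ <;> simp [fits] at h
    simp only [varSeq, binds, List.map_append] at hb
    obtain ⟨hb₁, hb₂⟩ := List.append_inj hb (by rw [List.length_map, length_binds q₁ _ h.1])
    simp [PropForm.subst, subst_eq_of_fits σ q₁ _ h.1 hb₁, subst_eq_of_fits σ q₂ _ h.2 hb₂]
  | .disj q₁ q₂, θ, h, hb => by
    cases θ <;> simp [fits] at h
    simp only [varSeq, binds, List.map_append] at hb
    obtain ⟨hb₁, hb₂⟩ := List.append_inj hb (by rw [List.length_map, length_binds q₁ _ h.1])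
    simp [PropForm.subst, subst_eq_of_fits σ q₁ _ h.1 hb₁, subst_eq_of_fits σ q₂ _ h.2 hb₂]

/-- Bindings are subformulas, hence their codes are no longer than the code of the matched
formula. [folklore] -/
theorem length_code_le_of_mem_binds :
    ∀ (p θ : PropForm ℕ) (χ : PropForm ℕ), χ ∈ binds p θ → χ.code.length ≤ θ.code.length
  | .var _, θ, χ, h => by simp [binds] at h; rw [h]
  | .const _, θ, χ, h => by simp [binds] at h
  | .neg q, θ, χ, h => by
    cases θ <;> simp [binds] at h
    exact (length_code_le_of_mem_binds q _ χ h).trans (by simp [PropForm.code]; omega)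
  | .conj q₁ q₂, θ, χ, h => by
    cases θ <;> simp [binds] at h
    rcases h with h | h
    · exact (length_code_le_of_mem_binds q₁ _ χ h).trans (by simp [PropForm.code]; omega)
    · exact (length_code_le_of_mem_binds q₂ _ χ h).trans (by simp [PropForm.code]; omega)
  | .disj q₁ q₂, θ, χ, h => by
    cases θ <;> simp [binds] at h
    rcases h with h | h
    · exact (length_code_le_of_mem_binds q₁ _ χ h).trans (by simp [PropForm.code]; omega)
    · exact (length_code_le_of_mem_binds q₂ _ χ h).trans (by simp [PropForm.code]; omega)

/-! ### Consistency of bindings and the matching substitution -/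

/-- The substitution read off from a binding list: the variable `x` of the pattern variables
`vs` is sent to the binding at its first occurrence, any other variable to `⊤`.
[Cook–Reckhow 1979, §2, proof of Thm. 2.3] [folklore] -/
def substOf (vs : List ℕ) (bs : List (PropForm ℕ)) (x : ℕ) : PropForm ℕ :=
  if x ∈ vs then bs.getD (vs.idxOf x) (.const true) else .const true

/-- `Consistent vs bs`: equal variables carry equal bindings (each occurrence agrees with the
first occurrence of its variable). [folklore] -/
def Consistent (vs : List ℕ) (bs : List (PropForm ℕ)) : Prop :=
  ∀ i : ℕ, i < vs.length → bs.getD i (.const true) = bs.getD (vs.idxOf (vs.getD i 0)) (.const true)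

/-- The bindings of an instance are consistent. [folklore] -/
theorem consistent_map (vs : List ℕ) (σ : ℕ → PropForm ℕ) : Consistent vs (vs.map σ) := by
  intro i hi
  have ha : vs.getD i 0 = vs[i] := by
    simp [List.getD_eq_getElem?_getD, List.getElem?_eq_getElem hi]
  have hidx : vs.idxOf vs[i] < vs.length := List.idxOf_lt_length_of_mem (List.getElem_mem hi)
  rw [ha]
  simp only [List.getD_eq_getElem?_getD, List.getElem?_map, List.getElem?_eq_getElem hi,
    List.getElem?_eq_getElem hidx, Option.map_some, Option.getD_some, List.getElem_idxOf]

/-- Consistent bindings of the right length are the values of `substOf`. [folklore] -/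
theorem map_substOf (vs : List ℕ) (bs : List (PropForm ℕ)) (hlen : bs.length = vs.length)
    (hc : Consistent vs bs) : vs.map (substOf vs bs) = bs := by
  apply List.ext_getElem (by simp [hlen])
  intro i h₁ h₂
  rw [List.getElem_map]
  have hi : i < vs.length := by simpa using h₁
  have hmem : vs[i] ∈ vs := List.getElem_mem hi
  have ha : vs.getD i 0 = vs[i] := by
    simp [List.getD_eq_getElem?_getD, List.getElem?_eq_getElem hi]
  have := hc i hi
  rw [ha, List.getD_eq_getElem?_getD, List.getElem?_eq_getElem h₂, Option.getD_some] at this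
  simp only [substOf, hmem, if_true]
  exact this.symm

/-- **Soundness of skeleton matching**: a formula fitting `p` with consistent bindings is the
instance of `p` under `substOf`. [Cook–Reckhow 1979, §2.1] [folklore] -/
theorem subst_substOf_eq {p θ : PropForm ℕ} (hf : fits p θ = true)
    (hc : Consistent (varSeq p) (binds p θ)) : p.subst (substOf (varSeq p) (binds p θ)) = θ :=
  subst_eq_of_fits _ p θ hf (map_substOf _ _ (length_binds p θ hf) hc).symm

/-- **Completeness of skeleton matching**: an instance fits, with consistent bindings.
[Cook–Reckhow 1979, §2.1] [folklore] -/
theorem fits_and_consistent_subst (p : PropForm ℕ) (σ : ℕ → PropForm ℕ) :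
    fits p (p.subst σ) = true ∧ Consistent (varSeq p) (binds p (p.subst σ)) := by
  refine ⟨(fits_subst p σ).1, ?_⟩
  rw [(fits_subst p σ).2]
  exact consistent_map _ _

/-! ### Layer M: skeleton decomposition of bit streams -/

/-- The splitter as a function of bit streams: `(code, siz, rest)` (cf. `splitFn_apply`).
[folklore] -/
def splitM (w : List Bool) : List Bool × List Bool × List Bool :=
  ((scanM^[w.length] ([], w, [true], [])).1, (scanM^[w.length] ([], w, [true], [])).2.2.2,
    (scanM^[w.length] ([], w, [true], [])).2.1)

/-- `splitFn` computes `splitM`. [folklore] -/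
theorem splitFn_eq_splitM (w : List Bool) :
    splitFn w = boolPair (splitM w).1 (boolPair (splitM w).2.1 (splitM w).2.2) := by
  rw [splitFn_apply]; rfl

/-- `splitM (code φ ++ rest) = (code φ, 1^{|φ|}, rest)`. [folklore] -/
theorem splitM_code (φ : PropForm ℕ) (rest : List Bool) :
    splitM (φ.code ++ rest) = (φ.code, List.replicate φ.size true, rest) := by
  have hk : φ.size ≤ (φ.code ++ rest).length := φ.size_le_length_code.trans (by simp)
  simp only [splitM]
  rw [scanM_iterate_code φ [] rest [] [] _ hk, scanM_iterate_of_nil]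
  simp

/-- **Skeleton decomposition** of a bit stream along a pattern `p`: the triple
`(ok, rest, bindings)` — whether the stream starts with the code of a formula fitting `p`
(tag bits compared node by node, variables of `p` matched by whole subformulas via `splitM`),
the unread rest, and the codes bound at the variable occurrences of `p` in preorder. Total on
all streams (mirroring the string function `skelS`). [Cook–Reckhow 1979, §2.1] [folklore] -/
def skelM : PropForm ℕ → List Bool → Bool × List Bool × List (List Bool)
  | .var _, w => (true, (splitM w).2.2, [(splitM w).1])
  | .const b, w => (decide (w.take 3 = [false, true, b]), w.tail.tail.tail, [])
  | .neg q, w =>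
    (decide (w.take 2 = [true, false]) && (skelM q w.tail.tail).1, (skelM q w.tail.tail).2.1,
      (skelM q w.tail.tail).2.2)
  | .conj q₁ q₂, w =>
    ((decide (w.take 3 = [true, true, false]) && (skelM q₁ w.tail.tail.tail).1) &&
        (skelM q₂ (skelM q₁ w.tail.tail.tail).2.1).1,
      (skelM q₂ (skelM q₁ w.tail.tail.tail).2.1).2.1,
      (skelM q₁ w.tail.tail.tail).2.2 ++ (skelM q₂ (skelM q₁ w.tail.tail.tail).2.1).2.2)
  | .disj q₁ q₂, w =>
    ((decide (w.take 3 = [true, true, true]) && (skelM q₁ w.tail.tail.tail).1) &&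
        (skelM q₂ (skelM q₁ w.tail.tail.tail).2.1).1,
      (skelM q₂ (skelM q₁ w.tail.tail.tail).2.1).2.1,
      (skelM q₁ w.tail.tail.tail).2.2 ++ (skelM q₂ (skelM q₁ w.tail.tail.tail).2.1).2.2)

/-- **`skelM` decides `fits` and computes `binds`** on streams `code θ ++ rest`.
[Cook–Reckhow 1979, §2.1] [folklore] -/
theorem skelM_code : ∀ (p θ : PropForm ℕ) (rest : List Bool),
    (skelM p (θ.code ++ rest)).1 = fits p θ ∧
    (fits p θ = true → skelM p (θ.code ++ rest) = (true, rest, (binds p θ).map PropForm.code))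
  | .var x, θ, rest => by simp [skelM, fits, binds, splitM_code]
  | .const b, θ, rest => by
    cases θ <;> simp [skelM, fits, binds, PropForm.code, boolPair]
  | .neg q, θ, rest => by
    cases θ with
    | neg θ =>
      have ih := skelM_code q θ rest
      simp only [skelM, fits, binds, PropForm.code, List.cons_append, List.tail_cons,
        List.take_succ_cons, List.take_zero, decide_true, Bool.true_and, ih.1, true_and]
      intro h
      rw [ih.2 h, h]
    | _ => simp [skelM, fits, PropForm.code]
  | .conj q₁ q₂, θ, rest => by
    cases θ with
    | conj θ₁ θ₂ =>
      have ih₁ := skelM_code q₁ θ₁ (θ₂.code ++ rest)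
      simp only [skelM, fits, binds, PropForm.code, List.cons_append, List.tail_cons,
        List.take_succ_cons, List.take_zero, decide_true, Bool.true_and, List.append_assoc, ih₁.1]
      by_cases h₁ : fits q₁ θ₁ = true
      · have ih₂ := skelM_code q₂ θ₂ rest
        rw [ih₁.2 h₁]
        simp only [h₁, Bool.true_and, ih₂.1, true_and, List.map_append]
        intro h₂
        rw [ih₂.2 h₂, h₂]
      · simp [h₁]
    | _ => simp [skelM, fits, PropForm.code]
  | .disj q₁ q₂, θ, rest => by
    cases θ with
    | disj θ₁ θ₂ =>
      have ih₁ := skelM_code q₁ θ₁ (θ₂.code ++ rest)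
      simp only [skelM, fits, binds, PropForm.code, List.cons_append, List.tail_cons,
        List.take_succ_cons, List.take_zero, decide_true, Bool.true_and, List.append_assoc, ih₁.1]
      by_cases h₁ : fits q₁ θ₁ = true
      · have ih₂ := skelM_code q₂ θ₂ rest
        rw [ih₁.2 h₁]
        simp only [h₁, Bool.true_and, ih₂.1, true_and, List.map_append]
        intro h₂
        rw [ih₂.2 h₂, h₂]
      · simp [h₁]
    | _ => simp [skelM, fits, PropForm.code]

/-- The `ok` flag of a skeleton decomposition of `code θ ++ rest` is `fits`. [folklore] -/
theorem skelM_code_fst (p θ : PropForm ℕ) (rest : List Bool) :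
    (skelM p (θ.code ++ rest)).1 = fits p θ := (skelM_code p θ rest).1

/-- A fitting skeleton decomposition returns the rest and the codes of the bindings. [folklore] -/
theorem skelM_code_of_fits {p θ : PropForm ℕ} (h : fits p θ = true) (rest : List Bool) :
    skelM p (θ.code ++ rest) = (true, rest, (binds p θ).map PropForm.code) := (skelM_code p θ rest).2 h

/-! ### Layer S: skeleton decomposition as a polynomial-time string function -/

/-- `takeK k w = w.take k` (through the coin truncation `truncSndFn (C k) ⟨[], w⟩`). [folklore] -/
noncomputable def takeK (k : ℕ) : List Bool → List Bool :=
  sndF ∘ truncSndFn (Polynomial.C k) ∘ fanoutFn (fun _ => []) id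

/-- `takeK k w = w.take k`. [folklore] -/
@[simp] theorem takeK_apply (k : ℕ) (w : List Bool) : takeK k w = w.take k := by
  simp [takeK, truncSndFn_boolPair]

/-- `takeK k ∈ FP`. [folklore] -/
theorem takeK_mem_FP (k : ℕ) : takeK k ∈ FP :=
  comp_mem_FP sndF_mem_FP (comp_mem_FP (truncSndFn_mem_FP _)
    (fanoutFn_mem_FP (const_mem_FP _) OracleCompose.id_mem_FP))

/-- The record `⟨[ok], ⟨rest, encList bindings⟩⟩` of a skeleton decomposition. [folklore] -/
def encSk (r : Bool × List Bool × List (List Bool)) : List Bool :=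
  boolPair [r.1] (boolPair r.2.1 (encList r.2.2))

/-- `encList` is a monoid morphism. [folklore] -/
theorem encList_append (l₁ l₂ : List (List Bool)) : encList (l₁ ++ l₂) = encList l₁ ++ encList l₂ := by
  induction l₁ with
  | nil => rfl
  | cons a l ih => simp [encList, ih, boolPair, List.append_assoc]

/-- The one-bit test "the stream starts with the bits `l`" (`|l|` bits compared). [folklore] -/
noncomputable def startsS (l : List Bool) : List Bool → List Bool :=
  eqPairFn ∘ fanoutFn (takeK l.length) (fun _ => l)

/-- `startsS l w = [decide (w.take |l| = l)]`. [folklore] -/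
@[simp] theorem startsS_apply (l w : List Bool) : startsS l w = [decide (w.take l.length = l)] := by
  simp [startsS, eqPairFn_boolPair]

/-- `startsS l ∈ FP`. [folklore] -/
theorem startsS_mem_FP (l : List Bool) : startsS l ∈ FP :=
  comp_mem_FP eqPairFn_mem_FP (fanoutFn_mem_FP (takeK_mem_FP _) (const_mem_FP _))

/-- **Skeleton decomposition as a string function**, by recursion on the pattern (mirroring
`skelM`; `skelS_apply`). [Cook–Reckhow 1979, §2.1] [folklore] -/
noncomputable def skelS : PropForm ℕ → (List Bool → List Bool)
  | .var _ => fanoutFn (fun _ => [true])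
      (fanoutFn (sndPow 1 ∘ splitFn) (fanoutFn (nthF 0 ∘ splitFn) (fun _ => [])))
  | .const b => fanoutFn (startsS [false, true, b])
      (fanoutFn (List.tail ∘ List.tail ∘ List.tail) (fun _ => []))
  | .neg q => fanoutFn (andFn (startsS [true, false]) (nthF 0 ∘ skelS q ∘ List.tail ∘ List.tail))
      (fanoutFn (nthF 1 ∘ skelS q ∘ List.tail ∘ List.tail)
        (sndPow 1 ∘ skelS q ∘ List.tail ∘ List.tail))
  | .conj q₁ q₂ =>
      fanoutFn (andFn (andFn (startsS [true, true, false])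
          (nthF 0 ∘ skelS q₁ ∘ List.tail ∘ List.tail ∘ List.tail))
          (nthF 0 ∘ skelS q₂ ∘ nthF 1 ∘ skelS q₁ ∘ List.tail ∘ List.tail ∘ List.tail))
        (fanoutFn (nthF 1 ∘ skelS q₂ ∘ nthF 1 ∘ skelS q₁ ∘ List.tail ∘ List.tail ∘ List.tail)
          (appendFn ∘ fanoutFn (sndPow 1 ∘ skelS q₁ ∘ List.tail ∘ List.tail ∘ List.tail)
            (sndPow 1 ∘ skelS q₂ ∘ nthF 1 ∘ skelS q₁ ∘ List.tail ∘ List.tail ∘ List.tail)))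
  | .disj q₁ q₂ =>
      fanoutFn (andFn (andFn (startsS [true, true, true])
          (nthF 0 ∘ skelS q₁ ∘ List.tail ∘ List.tail ∘ List.tail))
          (nthF 0 ∘ skelS q₂ ∘ nthF 1 ∘ skelS q₁ ∘ List.tail ∘ List.tail ∘ List.tail))
        (fanoutFn (nthF 1 ∘ skelS q₂ ∘ nthF 1 ∘ skelS q₁ ∘ List.tail ∘ List.tail ∘ List.tail)
          (appendFn ∘ fanoutFn (sndPow 1 ∘ skelS q₁ ∘ List.tail ∘ List.tail ∘ List.tail)
            (sndPow 1 ∘ skelS q₂ ∘ nthF 1 ∘ skelS q₁ ∘ List.tail ∘ List.tail ∘ List.tail)))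

/-- **`skelS p` computes `skelM p`**, on every stream. [folklore] -/
theorem skelS_apply : ∀ (p : PropForm ℕ) (w : List Bool), skelS p w = encSk (skelM p w)
  | .var x, w => by simp [skelS, skelM, encSk, splitFn_eq_splitM, encList]
  | .const b, w => by simp [skelS, skelM, encSk]
  | .neg q, w => by
    have ih := skelS_apply q w.tail.tail
    have h1 : startsS [true, false] w = [decide (w.take 2 = [true, false])] := startsS_apply _ _
    have h2 : (nthF 0 ∘ skelS q ∘ List.tail ∘ List.tail) w = [(skelM q w.tail.tail).1] := by
      simp [ih, encSk]
    simp only [skelS, fanoutFn_apply, andFn_apply h1 h2]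
    simp [ih, encSk, skelM]
  | .conj q₁ q₂, w => by
    have ih₁ := skelS_apply q₁ w.tail.tail.tail
    have ih₂ := skelS_apply q₂ (skelM q₁ w.tail.tail.tail).2.1
    have h1 : startsS [true, true, false] w = [decide (w.take 3 = [true, true, false])] :=
      startsS_apply _ _
    have h2 : (nthF 0 ∘ skelS q₁ ∘ List.tail ∘ List.tail ∘ List.tail) w =
        [(skelM q₁ w.tail.tail.tail).1] := by simp [ih₁, encSk]
    have h3 : (nthF 0 ∘ skelS q₂ ∘ nthF 1 ∘ skelS q₁ ∘ List.tail ∘ List.tail ∘ List.tail) w =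
        [(skelM q₂ (skelM q₁ w.tail.tail.tail).2.1).1] := by simp [ih₁, ih₂, encSk]
    simp only [skelS, fanoutFn_apply, andFn_apply (andFn_apply h1 h2) h3]
    simp [ih₁, ih₂, encSk, skelM, encList_append]
  | .disj q₁ q₂, w => by
    have ih₁ := skelS_apply q₁ w.tail.tail.tail
    have ih₂ := skelS_apply q₂ (skelM q₁ w.tail.tail.tail).2.1
    have h1 : startsS [true, true, true] w = [decide (w.take 3 = [true, true, true])] :=
      startsS_apply _ _
    have h2 : (nthF 0 ∘ skelS q₁ ∘ List.tail ∘ List.tail ∘ List.tail) w =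
        [(skelM q₁ w.tail.tail.tail).1] := by simp [ih₁, encSk]
    have h3 : (nthF 0 ∘ skelS q₂ ∘ nthF 1 ∘ skelS q₁ ∘ List.tail ∘ List.tail ∘ List.tail) w =
        [(skelM q₂ (skelM q₁ w.tail.tail.tail).2.1).1] := by simp [ih₁, ih₂, encSk]
    simp only [skelS, fanoutFn_apply, andFn_apply (andFn_apply h1 h2) h3]
    simp [ih₁, ih₂, encSk, skelM, encList_append]

/-- **`skelS p ∈ FP`** (by recursion on the pattern: fan-outs, conjunctions, the splitter).
[folklore] -/
theorem skelS_mem_FP : ∀ p : PropForm ℕ, skelS p ∈ FP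
  | .var _ => fanoutFn_mem_FP (const_mem_FP _) (fanoutFn_mem_FP (comp_mem_FP (sndPow_mem_FP 1) splitFn_mem_FP)
      (fanoutFn_mem_FP (comp_mem_FP (nthF_mem_FP 0) splitFn_mem_FP) (const_mem_FP _)))
  | .const _ => fanoutFn_mem_FP (startsS_mem_FP _) (fanoutFn_mem_FP
      (comp_mem_FP PRelSigma.tail_mem_FP (comp_mem_FP PRelSigma.tail_mem_FP PRelSigma.tail_mem_FP))
      (const_mem_FP _))
  | .neg q => by
    have hR : (skelS q ∘ List.tail ∘ List.tail) ∈ FP :=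
      comp_mem_FP (skelS_mem_FP q) (comp_mem_FP PRelSigma.tail_mem_FP PRelSigma.tail_mem_FP)
    exact fanoutFn_mem_FP (andFn_mem_FP (startsS_mem_FP _) (comp_mem_FP (nthF_mem_FP 0) hR))
      (fanoutFn_mem_FP (comp_mem_FP (nthF_mem_FP 1) hR) (comp_mem_FP (sndPow_mem_FP 1) hR))
  | .conj q₁ q₂ => by
    have hR₁ : (skelS q₁ ∘ List.tail ∘ List.tail ∘ List.tail) ∈ FP :=
      comp_mem_FP (skelS_mem_FP q₁) (comp_mem_FP PRelSigma.tail_mem_FP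
        (comp_mem_FP PRelSigma.tail_mem_FP PRelSigma.tail_mem_FP))
    have hR₂ : (skelS q₂ ∘ nthF 1 ∘ skelS q₁ ∘ List.tail ∘ List.tail ∘ List.tail) ∈ FP :=
      comp_mem_FP (skelS_mem_FP q₂) (comp_mem_FP (nthF_mem_FP 1) hR₁)
    exact fanoutFn_mem_FP (andFn_mem_FP (andFn_mem_FP (startsS_mem_FP _)
        (comp_mem_FP (nthF_mem_FP 0) hR₁)) (comp_mem_FP (nthF_mem_FP 0) hR₂))
      (fanoutFn_mem_FP (comp_mem_FP (nthF_mem_FP 1) hR₂) (comp_mem_FP appendFn_mem_FP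
        (fanoutFn_mem_FP (comp_mem_FP (sndPow_mem_FP 1) hR₁) (comp_mem_FP (sndPow_mem_FP 1) hR₂))))
  | .disj q₁ q₂ => by
    have hR₁ : (skelS q₁ ∘ List.tail ∘ List.tail ∘ List.tail) ∈ FP :=
      comp_mem_FP (skelS_mem_FP q₁) (comp_mem_FP PRelSigma.tail_mem_FP
        (comp_mem_FP PRelSigma.tail_mem_FP PRelSigma.tail_mem_FP))
    have hR₂ : (skelS q₂ ∘ nthF 1 ∘ skelS q₁ ∘ List.tail ∘ List.tail ∘ List.tail) ∈ FP :=
      comp_mem_FP (skelS_mem_FP q₂) (comp_mem_FP (nthF_mem_FP 1) hR₁)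
    exact fanoutFn_mem_FP (andFn_mem_FP (andFn_mem_FP (startsS_mem_FP _)
        (comp_mem_FP (nthF_mem_FP 0) hR₁)) (comp_mem_FP (nthF_mem_FP 0) hR₂))
      (fanoutFn_mem_FP (comp_mem_FP (nthF_mem_FP 1) hR₂) (comp_mem_FP appendFn_mem_FP
        (fanoutFn_mem_FP (comp_mem_FP (sndPow_mem_FP 1) hR₁) (comp_mem_FP (sndPow_mem_FP 1) hR₂))))

/-! ### Fields of `encList` records -/

/-- Field `i` of a coded list is its `i`-th element (`[]` beyond the end). [folklore] -/
theorem nthF_encList : ∀ (i : ℕ) (l : List (List Bool)), nthF i (encList l) = l.getD i []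
  | 0, [] => by simp [encList, fstF, boolUnpair]
  | 0, a :: l => by simp [encList]
  | i + 1, [] => by
    have : sndF [] = [] := by simp [sndF, boolUnpair]
    simp only [nthF, Function.comp_apply, encList_nil, this]
    simpa using nthF_encList i []
  | i + 1, a :: l => by simp [encList, nthF_encList i l]

/-! ### Consistency of the bound codes -/

/-- The index pairs `(i, first occurrence of vs[i])` along which consistency is tested.
[folklore] -/
def consPairs (vs : List ℕ) : List (ℕ × ℕ) :=
  (List.range vs.length).map fun i => (i, vs.idxOf (vs.getD i 0))

/-- Layer M: the conjunction of the equality tests of the fields `i`, `j` of `B`, `(i, j) ∈ ps`.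
[folklore] -/
def consM (ps : List (ℕ × ℕ)) (B : List Bool) : Bool :=
  ps.all fun ij => nthF ij.1 B == nthF ij.2 B

/-- Layer S: the same conjunction as a string function (nested `andFn` of `eqPairFn`).
[folklore] -/
noncomputable def consS : List (ℕ × ℕ) → (List Bool → List Bool)
  | [] => fun _ => [true]
  | ij :: ps => andFn (eqPairFn ∘ fanoutFn (nthF ij.1) (nthF ij.2)) (consS ps)

/-- `consS ps B = [consM ps B]`. [folklore] -/
theorem consS_apply : ∀ (ps : List (ℕ × ℕ)) (B : List Bool), consS ps B = [consM ps B]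
  | [], B => by simp [consS, consM]
  | ij :: ps, B => by
    have h1 : (eqPairFn ∘ fanoutFn (nthF ij.1) (nthF ij.2)) B = [decide (nthF ij.1 B = nthF ij.2 B)] := by
      simp [eqPairFn_boolPair]
    rw [consS, andFn_apply h1 (consS_apply ps B)]
    simp [consM, beq_eq_decide]

/-- `consS ps ∈ FP`. [folklore] -/
theorem consS_mem_FP : ∀ ps : List (ℕ × ℕ), consS ps ∈ FP
  | [] => const_mem_FP _
  | _ :: ps => andFn_mem_FP (comp_mem_FP eqPairFn_mem_FP
      (fanoutFn_mem_FP (nthF_mem_FP _) (nthF_mem_FP _))) (consS_mem_FP ps)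

/-- The prefix code is injective. [Arora–Barak 2009, §0.1] [folklore] -/
theorem code_injective : Function.Injective (PropForm.code) := by
  intro φ ψ h
  have hφ := PropForm.decodeAux_code_append φ (le_max_left φ.size ψ.size) []
  have hψ := PropForm.decodeAux_code_append ψ (le_max_right φ.size ψ.size) []
  rw [h] at hφ
  rw [hφ] at hψ
  simpa using hψ

/-- **The code-level consistency test decides `Consistent`** on the bindings of a fitting
formula. [folklore] -/
theorem consM_consPairs_iff (vs : List ℕ) (bs : List (PropForm ℕ)) (hlen : bs.length = vs.length) :
    consM (consPairs vs) (encList (bs.map PropForm.code)) = true ↔ Consistent vs bs := by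
  simp only [consM, consPairs, List.all_map, List.all_eq_true, List.mem_range, Function.comp_apply,
    beq_iff_eq, nthF_encList, Consistent]
  refine forall_congr' fun i => forall_congr' fun hi => ?_
  have hj : vs.idxOf (vs.getD i 0) < vs.length := by
    apply List.idxOf_lt_length_of_mem
    rw [List.getD_eq_getElem?_getD, List.getElem?_eq_getElem hi]
    exact List.getElem_mem hi
  generalize vs.idxOf (vs.getD i 0) = j at hj ⊢
  rw [List.getD_eq_getElem _ _ (by simp; omega), List.getD_eq_getElem _ _ (by simp; omega),
    List.getD_eq_getElem _ _ (by omega), List.getD_eq_getElem _ _ (by omega), List.getElem_map,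
    List.getElem_map]
  exact code_injective.eq_iff

/-! ### Emission: substituted codes, coded lines, blocks -/

/-- Layer M: the code of `ℓ σ'` where `σ'` sends the pattern variable `vs[i]` to the formula
coded in field `idxOf` of the binding record `B`, and every other variable to `⊤`.
[Cook–Reckhow 1979, §2, proof of Thm. 2.3 (`σ_i(π_{R_i})`)] [folklore] -/
def codeσM (vs : List ℕ) (B : List Bool) : PropForm ℕ → List Bool
  | .var y => if y ∈ vs then nthF (vs.idxOf y) B else [false, true, true]
  | .const b => [false, true, b]
  | .neg ℓ => true :: false :: codeσM vs B ℓ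
  | .conj ℓ₁ ℓ₂ => true :: true :: false :: (codeσM vs B ℓ₁ ++ codeσM vs B ℓ₂)
  | .disj ℓ₁ ℓ₂ => true :: true :: true :: (codeσM vs B ℓ₁ ++ codeσM vs B ℓ₂)

/-- Layer S: the same, as a string function of the binding record. [folklore] -/
noncomputable def codeσS (vs : List ℕ) : PropForm ℕ → (List Bool → List Bool)
  | .var y => if y ∈ vs then nthF (vs.idxOf y) else fun _ => [false, true, true]
  | .const b => fun _ => [false, true, b]
  | .neg ℓ => List.cons true ∘ List.cons false ∘ codeσS vs ℓ
  | .conj ℓ₁ ℓ₂ => List.cons true ∘ List.cons true ∘ List.cons false ∘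
      (appendFn ∘ fanoutFn (codeσS vs ℓ₁) (codeσS vs ℓ₂))
  | .disj ℓ₁ ℓ₂ => List.cons true ∘ List.cons true ∘ List.cons true ∘
      (appendFn ∘ fanoutFn (codeσS vs ℓ₁) (codeσS vs ℓ₂))

/-- `codeσS vs ℓ B = codeσM vs B ℓ`. [folklore] -/
theorem codeσS_apply (vs : List ℕ) (B : List Bool) : ∀ ℓ : PropForm ℕ, codeσS vs ℓ B = codeσM vs B ℓ
  | .var y => by unfold codeσS codeσM; split_ifs <;> rfl
  | .const b => rfl
  | .neg ℓ => by simp [codeσS, codeσM, codeσS_apply vs B ℓ]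
  | .conj ℓ₁ ℓ₂ => by simp [codeσS, codeσM, codeσS_apply vs B ℓ₁, codeσS_apply vs B ℓ₂]
  | .disj ℓ₁ ℓ₂ => by simp [codeσS, codeσM, codeσS_apply vs B ℓ₁, codeσS_apply vs B ℓ₂]

/-- `codeσS vs ℓ ∈ FP`. [folklore] -/
theorem codeσS_mem_FP (vs : List ℕ) : ∀ ℓ : PropForm ℕ, codeσS vs ℓ ∈ FP
  | .var y => by unfold codeσS; split_ifs; exacts [nthF_mem_FP _, const_mem_FP _]
  | .const b => const_mem_FP _
  | .neg ℓ => comp_mem_FP (cons_mem_FP _) (comp_mem_FP (cons_mem_FP _) (codeσS_mem_FP vs ℓ))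
  | .conj ℓ₁ ℓ₂ => comp_mem_FP (cons_mem_FP _) (comp_mem_FP (cons_mem_FP _) (comp_mem_FP (cons_mem_FP _)
      (comp_mem_FP appendFn_mem_FP (fanoutFn_mem_FP (codeσS_mem_FP vs ℓ₁) (codeσS_mem_FP vs ℓ₂)))))
  | .disj ℓ₁ ℓ₂ => comp_mem_FP (cons_mem_FP _) (comp_mem_FP (cons_mem_FP _) (comp_mem_FP (cons_mem_FP _)
      (comp_mem_FP appendFn_mem_FP (fanoutFn_mem_FP (codeσS_mem_FP vs ℓ₁) (codeσS_mem_FP vs ℓ₂)))))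

/-- **`codeσM` computes the code of the substituted line**: if `B` codes the bindings `bs`
(`|bs| = |vs|`), then `codeσM vs B ℓ = code (ℓ (substOf vs bs))`. [Cook–Reckhow 1979, Lemma 2.5]
[folklore] -/
theorem codeσM_eq_code_subst (vs : List ℕ) (bs : List (PropForm ℕ)) (hlen : bs.length = vs.length) :
    ∀ ℓ : PropForm ℕ, codeσM vs (encList (bs.map PropForm.code)) ℓ =
      (ℓ.subst (substOf vs bs)).code
  | .var y => by
    by_cases hy : y ∈ vs
    · have hidx : vs.idxOf y < bs.length := hlen ▸ List.idxOf_lt_length_of_mem hy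
      simp only [codeσM, hy, if_true, PropForm.subst, substOf, nthF_encList]
      rw [List.getD_eq_getElem?_getD, List.getElem?_map, List.getElem?_eq_getElem hidx,
        List.getD_eq_getElem?_getD, List.getElem?_eq_getElem hidx]
      simp
    · simp [codeσM, hy, PropForm.subst, substOf, PropForm.code]
  | .const b => by simp [codeσM, PropForm.subst, PropForm.code]
  | .neg ℓ => by simp [codeσM, PropForm.subst, PropForm.code, codeσM_eq_code_subst vs bs hlen ℓ]
  | .conj ℓ₁ ℓ₂ => by
    simp [codeσM, PropForm.subst, PropForm.code, codeσM_eq_code_subst vs bs hlen ℓ₁,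
      codeσM_eq_code_subst vs bs hlen ℓ₂]
  | .disj ℓ₁ ℓ₂ => by
    simp [codeσM, PropForm.subst, PropForm.code, codeσM_eq_code_subst vs bs hlen ℓ₁,
      codeσM_eq_code_subst vs bs hlen ℓ₂]

/-- The code word of a formula in terms of its prefix code: `encode φ = ⟨1^{|φ|}, code φ⟩`.
[folklore] -/
theorem encode_propForm_eq (φ : PropForm ℕ) :
    encodingPropForm.encode φ = boolPair (List.replicate φ.size true) φ.code := by
  simp [encodingPropForm, OracleCompose.unaryEncodeNat_eq_replicate]

/-- Layer M: the code word `⟨1^{size}, code⟩` of a line, the size read off its code by the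
splitter. [folklore] -/
def encLineM (vs : List ℕ) (B : List Bool) (ℓ : PropForm ℕ) : List Bool :=
  boolPair (splitM (codeσM vs B ℓ)).2.1 (codeσM vs B ℓ)

/-- Layer S: the same as a string function. [folklore] -/
noncomputable def encLineS (vs : List ℕ) (ℓ : PropForm ℕ) : List Bool → List Bool :=
  fanoutFn (nthF 1 ∘ splitFn ∘ codeσS vs ℓ) (codeσS vs ℓ)

/-- `encLineS vs ℓ B = encLineM vs B ℓ`. [folklore] -/
theorem encLineS_apply (vs : List ℕ) (ℓ : PropForm ℕ) (B : List Bool) :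
    encLineS vs ℓ B = encLineM vs B ℓ := by
  simp [encLineS, encLineM, codeσS_apply, splitFn_eq_splitM]

/-- `encLineS vs ℓ ∈ FP`. [folklore] -/
theorem encLineS_mem_FP (vs : List ℕ) (ℓ : PropForm ℕ) : encLineS vs ℓ ∈ FP :=
  fanoutFn_mem_FP (comp_mem_FP (nthF_mem_FP 1) (comp_mem_FP splitFn_mem_FP (codeσS_mem_FP vs ℓ)))
    (codeσS_mem_FP vs ℓ)

/-- **The emitted line is the code word of the substituted line.** [Cook–Reckhow 1979, Lemma 2.5]
[folklore] -/
theorem encLineM_eq_encode (vs : List ℕ) (bs : List (PropForm ℕ)) (hlen : bs.length = vs.length)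
    (ℓ : PropForm ℕ) : encLineM vs (encList (bs.map PropForm.code)) ℓ =
      encodingPropForm.encode (ℓ.subst (substOf vs bs)) := by
  rw [encLineM, codeσM_eq_code_subst vs bs hlen, encode_propForm_eq]
  have h := splitM_code (ℓ.subst (substOf vs bs)) []
  rw [List.append_nil] at h
  rw [h]

/-- Layer M: the block of coded lines of the derivation `D` (an `encList`). [folklore] -/
def blockM (vs : List ℕ) (B : List Bool) : List (PropForm ℕ) → List Bool
  | [] => []
  | ℓ :: D => boolPair (encLineM vs B ℓ) (blockM vs B D)

/-- Layer S: the same as a string function. [folklore] -/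
noncomputable def blockS (vs : List ℕ) : List (PropForm ℕ) → (List Bool → List Bool)
  | [] => fun _ => []
  | ℓ :: D => fanoutFn (encLineS vs ℓ) (blockS vs D)

/-- `blockS vs D B = blockM vs B D`. [folklore] -/
theorem blockS_apply (vs : List ℕ) (B : List Bool) : ∀ D : List (PropForm ℕ), blockS vs D B = blockM vs B D
  | [] => rfl
  | ℓ :: D => by simp [blockS, blockM, encLineS_apply, blockS_apply vs B D]

/-- `blockS vs D ∈ FP`. [folklore] -/
theorem blockS_mem_FP (vs : List ℕ) : ∀ D : List (PropForm ℕ), blockS vs D ∈ FP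
  | [] => const_mem_FP _
  | ℓ :: D => fanoutFn_mem_FP (encLineS_mem_FP vs ℓ) (blockS_mem_FP vs D)

/-- **The emitted block codes the substituted derivation** `σ'(D)` as a list of code words.
[Cook–Reckhow 1979, §2, proof of Thm. 2.3] [folklore] -/
theorem blockM_eq_encList (vs : List ℕ) (bs : List (PropForm ℕ)) (hlen : bs.length = vs.length) :
    ∀ D : List (PropForm ℕ), blockM vs (encList (bs.map PropForm.code)) D =
      encList (D.map fun ℓ => encodingPropForm.encode (ℓ.subst (substOf vs bs)))
  | [] => rfl
  | ℓ :: D => by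
    rw [blockM, encLineM_eq_encode vs bs hlen, blockM_eq_encList vs bs hlen D]
    rfl

/-! ### Matching one rule against a candidate tuple of lines -/

/-- The conjunction chain `q₁ ∧ (q₂ ∧ (… ∧ ⊤))`. (Coincides with `PropForm.bigAnd` of
`MetaComplexity/EFScaffold.lean`, which cannot be imported here: that file imports
`ProofComplexityProofs.lean`, the intended importer of this one.) [folklore] -/
def bigConj : List (PropForm ℕ) → PropForm ℕ
  | [] => .const true
  | q :: qs => .conj q (bigConj qs)

/-- Substitution commutes with conjunction chains. [folklore] -/
theorem bigConj_subst (σ : ℕ → PropForm ℕ) : ∀ qs : List (PropForm ℕ),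
    (bigConj qs).subst σ = bigConj (qs.map (PropForm.subst σ))
  | [] => rfl
  | q :: qs => by simp [bigConj, PropForm.subst, bigConj_subst σ qs]

/-- Conjunction chains are injective. [folklore] -/
theorem bigConj_injective : Function.Injective bigConj := by
  intro qs
  induction qs with
  | nil => intro qs' h; cases qs' <;> simp_all [bigConj]
  | cons q qs ih =>
    intro qs' h
    cases qs' with
    | nil => simp [bigConj] at h
    | cons q' qs' =>
      simp only [bigConj, PropForm.conj.injEq] at h
      rw [h.1, ih h.2]

/-- The pattern of a rule: the conjunction chain of its conclusion and premises. A tuple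
`(θ, ℓ₁, …, ℓ_m)` is an instance of the rule (conclusion `θ`, premises `ℓᵢ`) under `σ` iff
`bigConj (θ :: ℓs) = (rulePat r) σ`. [Cook–Reckhow 1979, §2.1] [folklore] -/
def rulePat (r : FregeRule) : PropForm ℕ := bigConj (r.conclusion :: r.premises)

/-- The middle part of the code of a conjunction chain: `110 · code ℓ` for each further conjunct.
[folklore] -/
def preOf : List (List Bool) → List Bool
  | [] => []
  | c :: cs => true :: true :: false :: (c ++ preOf cs)

/-- `preOf` is a monoid morphism. [folklore] -/
theorem preOf_append (cs₁ cs₂ : List (List Bool)) : preOf (cs₁ ++ cs₂) = preOf cs₁ ++ preOf cs₂ := by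
  induction cs₁ with
  | nil => rfl
  | cons c cs ih => simp [preOf, ih]

/-- The code of a nonempty conjunction chain. [folklore] -/
theorem code_bigConj_cons : ∀ (θ : PropForm ℕ) (ℓs : List (PropForm ℕ)),
    (bigConj (θ :: ℓs)).code =
      true :: true :: false :: (θ.code ++ (preOf (ℓs.map PropForm.code) ++ [false, true, true]))
  | θ, [] => by simp [bigConj, PropForm.code, preOf]
  | θ, ℓ :: ℓs => by
    rw [bigConj, PropForm.code, code_bigConj_cons ℓ ℓs]
    simp [preOf]

/-- Layer M: the candidate stream `110 · θc · pre · 011`. [folklore] -/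
def streamM (θc pre : List Bool) : List Bool :=
  true :: true :: false :: (θc ++ (pre ++ [false, true, true]))

/-- On genuine codes the candidate stream is the code of the conjunction chain. [folklore] -/
theorem streamM_code (θ : PropForm ℕ) (ℓs : List (PropForm ℕ)) :
    streamM θ.code (preOf (ℓs.map PropForm.code)) = (bigConj (θ :: ℓs)).code ++ [] := by
  rw [List.append_nil, code_bigConj_cons]; rfl

/-- Layer S: the candidate stream from the record `⟨x, ⟨E, ⟨θc, pre⟩⟩⟩`. [folklore] -/
noncomputable def streamS : List Bool → List Bool :=
  List.cons true ∘ List.cons true ∘ List.cons false ∘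
    (appendFn ∘ fanoutFn (nthF 2) (appendFn ∘ fanoutFn (sndPow 2) (fun _ => [false, true, true])))

/-- `streamS z = streamM θc pre`. [folklore] -/
@[simp] theorem streamS_apply (z : List Bool) : streamS z = streamM (nthF 2 z) (sndPow 2 z) := by
  simp [streamS, streamM]

/-- `streamS ∈ FP`. [folklore] -/
theorem streamS_mem_FP : streamS ∈ FP :=
  comp_mem_FP (cons_mem_FP _) (comp_mem_FP (cons_mem_FP _) (comp_mem_FP (cons_mem_FP _)
    (comp_mem_FP appendFn_mem_FP (fanoutFn_mem_FP (nthF_mem_FP 2) (comp_mem_FP appendFn_mem_FP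
      (fanoutFn_mem_FP (sndPow_mem_FP 2) (const_mem_FP _)))))))

/-- Layer M: does the candidate stream match the rule `r`? (skeleton fits and bindings are
consistent). [Cook–Reckhow 1979, §2.1] [folklore] -/
def matchOkM (r : FregeRule) (θc pre : List Bool) : Bool :=
  (skelM (rulePat r) (streamM θc pre)).1 &&
    consM (consPairs (varSeq (rulePat r))) (encList (skelM (rulePat r) (streamM θc pre)).2.2)

/-- Layer M: the block emitted for a match (meaningful when `matchOkM`). [folklore] -/
def matchBlkM (r : FregeRule) (D : List (PropForm ℕ)) (θc pre : List Bool) : List Bool :=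
  blockM (varSeq (rulePat r)) (encList (skelM (rulePat r) (streamM θc pre)).2.2) D

/-- Layer S: **the matcher of the rule `r`** with `F₁`-derivation `D` and cap constant `c`: on
`⟨x, ⟨E, ⟨θc, pre⟩⟩⟩`, the record `⟨[ok], block ↾ c(|x|+1)⟩` (clipped by the tree's `Brick.clipF`).
[cite: CookReckhow1979, Thm. 2.3 (proof)] -/
noncomputable def matchS (r : FregeRule) (D : List (PropForm ℕ)) (c : ℕ) : List Bool → List Bool :=
  fanoutFn (andFn (nthF 0 ∘ skelS (rulePat r) ∘ streamS)
      (consS (consPairs (varSeq (rulePat r))) ∘ sndPow 1 ∘ skelS (rulePat r) ∘ streamS))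
    (clipF c (blockS (varSeq (rulePat r)) D ∘ sndPow 1 ∘ skelS (rulePat r) ∘ streamS))

/-- `matchS` computes `matchOkM` and the capped `matchBlkM`, on every word. [folklore] -/
theorem matchS_apply (r : FregeRule) (D : List (PropForm ℕ)) (c : ℕ) (z : List Bool) :
    matchS r D c z = boolPair [matchOkM r (nthF 2 z) (sndPow 2 z)]
      ((matchBlkM r D (nthF 2 z) (sndPow 2 z)).take (c * ((fstF z).length + 1))) := by
  have h1 : (nthF 0 ∘ skelS (rulePat r) ∘ streamS) z =
      [(skelM (rulePat r) (streamM (nthF 2 z) (sndPow 2 z))).1] := by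
    simp [skelS_apply, encSk]
  have h2 : (consS (consPairs (varSeq (rulePat r))) ∘ sndPow 1 ∘ skelS (rulePat r) ∘ streamS) z =
      [consM (consPairs (varSeq (rulePat r)))
        (encList (skelM (rulePat r) (streamM (nthF 2 z) (sndPow 2 z))).2.2)] := by
    simp [skelS_apply, encSk, consS_apply]
  rw [matchS, fanoutFn_apply, andFn_apply h1 h2]
  simp [matchOkM, matchBlkM, skelS_apply, encSk, blockS_apply, clipF_apply]

/-- `matchS r D c ∈ FP`. [folklore] -/
theorem matchS_mem_FP (r : FregeRule) (D : List (PropForm ℕ)) (c : ℕ) : matchS r D c ∈ FP := by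
  have hR : (skelS (rulePat r) ∘ streamS) ∈ FP := comp_mem_FP (skelS_mem_FP _) streamS_mem_FP
  have hB : (sndPow 1 ∘ skelS (rulePat r) ∘ streamS) ∈ FP := comp_mem_FP (sndPow_mem_FP 1) hR
  exact fanoutFn_mem_FP (andFn_mem_FP (comp_mem_FP (nthF_mem_FP 0) hR) (comp_mem_FP (consS_mem_FP _) hB))
    (clipF_mem_FP c (comp_mem_FP (blockS_mem_FP _ _) hB))

/-- **Soundness and output of the matcher on genuine codes.** If the candidate `(θ, ℓs)` matches
the rule `r`, then with `σ' = substOf (varSeq P) (binds P Θ)` (`P = rulePat r`,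
`Θ = bigConj (θ :: ℓs)`): `θ = r.conclusion σ'`, `ℓs = r.premises σ'`, and the block is the
list of code words of `σ'(D)`. [cite: CookReckhow1979, Thm. 2.3 (proof)]
[cite: CookReckhow1979, Lemma 2.5] -/
theorem matchOkM_sound {r : FregeRule} {θ : PropForm ℕ} {ℓs : List (PropForm ℕ)}
    (h : matchOkM r θ.code (preOf (ℓs.map PropForm.code)) = true) (D : List (PropForm ℕ)) :
    let σ' := substOf (varSeq (rulePat r)) (binds (rulePat r) (bigConj (θ :: ℓs)))
    r.conclusion.subst σ' = θ ∧ r.premises.map (PropForm.subst σ') = ℓs ∧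
    matchBlkM r D θ.code (preOf (ℓs.map PropForm.code)) =
      encList (D.map fun ℓ => encodingPropForm.encode (ℓ.subst σ')) := by
  intro σ'
  rw [matchOkM, streamM_code, skelM_code_fst] at h
  simp only [Bool.and_eq_true] at h
  obtain ⟨hfit, hcons⟩ := h
  rw [skelM_code_of_fits hfit] at hcons
  have hlen := length_binds _ _ hfit
  rw [consM_consPairs_iff _ _ hlen] at hcons
  have hinst := subst_substOf_eq hfit hcons
  rw [rulePat, bigConj_subst] at hinst
  have hinst' := bigConj_injective hinst
  simp only [List.map_cons, List.cons.injEq] at hinst'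
  refine ⟨hinst'.1, hinst'.2, ?_⟩
  rw [matchBlkM, streamM_code, skelM_code_of_fits hfit]
  exact blockM_eq_encList _ _ hlen D

/-- **Completeness of the matcher on genuine codes**: an instance of the rule matches.
[cite: CookReckhow1979, Def. 2.1] -/
theorem matchOkM_complete (r : FregeRule) (σ : ℕ → PropForm ℕ) :
    matchOkM r (r.conclusion.subst σ).code
      (preOf ((r.premises.map (PropForm.subst σ)).map PropForm.code)) = true := by
  have hΘ : bigConj (r.conclusion.subst σ :: r.premises.map (PropForm.subst σ)) = (rulePat r).subst σ := by
    rw [rulePat, bigConj_subst]; rfl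
  obtain ⟨hfit, hcons⟩ := fits_and_consistent_subst (rulePat r) σ
  rw [← hΘ] at hfit hcons
  rw [matchOkM, streamM_code, skelM_code_fst, hfit, Bool.true_and, skelM_code_of_fits hfit,
    consM_consPairs_iff _ _ (length_binds _ _ hfit)]
  exact hcons



/-! ### The clocked list-fold loop -/

/-- **The clocked list-fold loop**: `p(|x|)` rounds of the tree's list-fold round
`Brick.foldRound G` (`ListFoldBricks.lean`) on records `⟨x, ⟨rest, st⟩⟩` — each round removes the
first item `a` of the coded list `rest` and replaces the state by `G ⟨x, ⟨a, st⟩⟩`, idling once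
`rest` is exhausted. (A thin wrapper: unlike the packaged `Brick.foldFn`, the loops of this file
start from records they build themselves and need the round counts `X` and `M · X`.)
[cite: AroraBarak2009, §1.3 (bounded loops)] -/
noncomputable def feLoop (p : Polynomial ℕ) (G : List Bool → List Bool) : List Bool → List Bool :=
  fun z => (foldRound G)^[p.eval (boolUnpair z).1.length] z

/-- **`feLoop p G ∈ FP`** for a body in `FP` of linear growth (`Brick.FoldGrowth c G`:
`|G ⟨x, ⟨a, st⟩⟩| ≤ |st| + 4|a| + c(|x| + 1)`, stated totally), by `iterate_mem_FP_of_growth`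
with `length_foldRound_le`. [cite: AroraBarak2009, §1.4.1] -/
theorem feLoop_mem_FP (p : Polynomial ℕ) {G : List Bool → List Bool} (hG : G ∈ FP) {c : ℕ}
    (hlen : FoldGrowth c G) : feLoop p G ∈ FP :=
  iterate_mem_FP_of_growth (foldRound_mem_FP hG) (c + 4) (fun w => fstF_foldRound G w)
    (fun w => length_foldRound_le hlen w) p

/-- **Semantics of `feLoop`** on a record with a coded list of at most `p(|x|)` items: the list is
exhausted and the state is the left fold of the body over the items (`iterate_foldRound` with
`decNil_encList`). [folklore] -/
theorem feLoop_rec (p : Polynomial ℕ) (G : List Bool → List Bool) (x : List Bool)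
    (l : List (List Bool)) (st : List Bool) (hl : l.length ≤ p.eval x.length) :
    feLoop p G (boolPair x (boolPair (encList l) st)) =
      boolPair x (boolPair [] (l.foldl (fun st a => G (boolPair x (boolPair a st))) st)) := by
  simp only [feLoop, boolUnpair_boolPair]
  rw [iterate_foldRound G x (encList l) st _ (by simpa using hl), decNil_encList]

/-! ### The search over tuples of earlier lines -/

/-- Records `⟨x, ⟨E, ⟨θc, pre⟩⟩⟩`: input, coded earlier lines, code of the current line, stream
of the candidate premises chosen so far. [folklore] -/
def rec4 (x E θc pre : List Bool) : List Bool := boolPair x (boolPair E (boolPair θc pre))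

/-- Search states `⟨flag, ⟨res, ⟨E, ⟨θc, pre⟩⟩⟩⟩`. [folklore] -/
def seSt (flag res E θc pre : List Bool) : List Bool :=
  boolPair flag (boolPair res (boolPair E (boolPair θc pre)))

/-- Entering a search level: the loop record `⟨x, ⟨E, ⟨[0], ⟨[], ⟨E, ⟨θc, pre⟩⟩⟩⟩⟩⟩`.
[folklore] -/
noncomputable def seIn : List Bool → List Bool :=
  fanoutFn fstF (fanoutFn (nthF 1) (fanoutFn (fun _ => [false]) (fanoutFn (fun _ => [])
    (fanoutFn (nthF 1) (fanoutFn (nthF 2) (sndPow 2))))))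

/-- The argument of the inner search from a body record `⟨x, ⟨item, st⟩⟩`:
`⟨x, ⟨E, ⟨θc, pre · 110 · item⟩⟩⟩`. [folklore] -/
noncomputable def seArg : List Bool → List Bool :=
  fanoutFn fstF (fanoutFn (nthF 4) (fanoutFn (nthF 5)
    (appendFn ∘ fanoutFn (sndPow 5) (List.cons true ∘ List.cons true ∘ List.cons false ∘ nthF 1))))

/-- The state rebuilt from a body record (idle branch). [folklore] -/
noncomputable def seKeep : List Bool → List Bool :=
  fanoutFn (nthF 2) (fanoutFn (nthF 3) (fanoutFn (nthF 4) (fanoutFn (nthF 5) (sndPow 5))))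

/-- **The body of a search level**: if the flag is set, idle; otherwise run the inner search `S`
on the extended tuple and record its (one-bit) flag and (capped) result. [folklore] -/
noncomputable def seBody (c : ℕ) (S : List Bool → List Bool) : List Bool → List Bool :=
  iteFn (headBitFn ∘ nthF 2) seKeep
    (fanoutFn (headBitFn ∘ fstF ∘ S ∘ seArg) (fanoutFn (clipF c (sndF ∘ S ∘ seArg))
      (fanoutFn (nthF 4) (fanoutFn (nthF 5) (sndPow 5)))))

/-- Leaving a search level: `⟨flag, res⟩` of the final loop record. [folklore] -/
noncomputable def seOut : List Bool → List Bool := fanoutFn (nthF 2) (nthF 3)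

/-- **The search of a rule instance over tuples of earlier lines**, by recursion on the list of
premises still to be chosen: a list-fold loop over the earlier lines per premise, the matcher
`mt` innermost. Input `⟨x, ⟨E, ⟨θc, pre⟩⟩⟩`, output `⟨[flag], res⟩` ("if `B_i` follows from
earlier `B_j`'s by the rule `R_i` and substitution `σ_i`": the search recovers such `R_i`, `σ_i`).
[cite: CookReckhow1979, Thm. 2.3 (proof)] -/
noncomputable def searchS (c : ℕ) (mt : List Bool → List Bool) : List (PropForm ℕ) → (List Bool → List Bool)
  | [] => mt
  | _ :: As => seOut ∘ feLoop Polynomial.X (seBody c (searchS c mt As)) ∘ seIn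

/-- `seBody` on a body record. [folklore] -/
theorem seBody_rec (c : ℕ) (S : List Bool → List Bool) (x a flag res E θc pre : List Bool) :
    seBody c S (boolPair x (boolPair a (seSt flag res E θc pre))) =
      if flag.headD false then seSt flag res E θc pre
      else seSt [(fstF (S (rec4 x E θc (pre ++ true :: true :: false :: a)))).headD false]
        ((sndF (S (rec4 x E θc (pre ++ true :: true :: false :: a)))).take (c * (x.length + 1)))
        E θc pre := by
  have hc : (headBitFn ∘ nthF 2) (boolPair x (boolPair a (seSt flag res E θc pre))) = [flag.headD false] := by
    simp [seSt, headBitFn_apply]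
  rw [seBody, iteFn_apply hc]
  cases flag.headD false
  · simp [seSt, seArg, rec4, headBitFn_apply, clipF_apply]
  · simp [seSt, seKeep]

/-- **Growth of the search body** (`Brick.FoldGrowth`): on `⟨x, ⟨a, st⟩⟩` the new state is at most
`(2c + 10)(|x| + 1)` longer than `st` (flag one bit, result clipped, context rebuilt) — stated on
every word through the projections. [folklore] -/
theorem foldGrowth_seBody (c : ℕ) (S : List Bool → List Bool) : FoldGrowth (2 * c + 10) (seBody c S) := by
  intro z
  set st := sndF (sndF z) with hst
  have e2 : nthF 2 z = nthF 0 st := rfl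
  have e3 : nthF 3 z = nthF 1 st := rfl
  have e4 : nthF 4 z = nthF 2 st := rfl
  have e5 : nthF 5 z = nthF 3 st := rfl
  have e6 : sndPow 5 z = sndPow 3 st := rfl
  have h0 := length_fstF_sndF_le st
  have h1 : 2 * (nthF 1 st).length + (sndPow 1 st).length ≤ (sndF st).length := by
    simpa using length_nthF_succ_add_sndPow_succ_le 0 st
  have h2 : 2 * (nthF 2 st).length + (sndPow 2 st).length ≤ (sndPow 1 st).length := by
    simpa using length_nthF_succ_add_sndPow_succ_le 1 st
  have h3 : 2 * (nthF 3 st).length + (sndPow 3 st).length ≤ (sndPow 2 st).length := by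
    simpa using length_nthF_succ_add_sndPow_succ_le 2 st
  rw [seBody, iteFn_of_oneBit ((HashBricks.oneBit_headBitFn).comp _)]
  split_ifs
  · simp only [seKeep, fanoutFn_apply, length_boolPair, e2, e3, e4, e5, e6, nthF_zero] at *
    nlinarith
  · simp only [fanoutFn_apply, length_boolPair, Function.comp_apply, headBitFn_apply,
      List.length_singleton, e4, e5, e6] at *
    have hclip := length_clipF_le c (sndF ∘ S ∘ seArg) z
    nlinarith

/-- `seIn`, `seArg`, `seKeep`, `seOut` are in `FP`. [folklore] -/
theorem seIn_mem_FP : seIn ∈ FP :=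
  fanoutFn_mem_FP fstF_mem_FP (fanoutFn_mem_FP (nthF_mem_FP 1) (fanoutFn_mem_FP (const_mem_FP _)
    (fanoutFn_mem_FP (const_mem_FP _) (fanoutFn_mem_FP (nthF_mem_FP 1)
      (fanoutFn_mem_FP (nthF_mem_FP 2) (sndPow_mem_FP 2))))))

/-- `seArg ∈ FP`. [folklore] -/
theorem seArg_mem_FP : seArg ∈ FP :=
  fanoutFn_mem_FP fstF_mem_FP (fanoutFn_mem_FP (nthF_mem_FP 4) (fanoutFn_mem_FP (nthF_mem_FP 5)
    (comp_mem_FP appendFn_mem_FP (fanoutFn_mem_FP (sndPow_mem_FP 5) (comp_mem_FP (cons_mem_FP _)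
      (comp_mem_FP (cons_mem_FP _) (comp_mem_FP (cons_mem_FP _) (nthF_mem_FP 1))))))))

/-- `seKeep ∈ FP`. [folklore] -/
theorem seKeep_mem_FP : seKeep ∈ FP :=
  fanoutFn_mem_FP (nthF_mem_FP 2) (fanoutFn_mem_FP (nthF_mem_FP 3) (fanoutFn_mem_FP (nthF_mem_FP 4)
    (fanoutFn_mem_FP (nthF_mem_FP 5) (sndPow_mem_FP 5))))

/-- `seBody c S ∈ FP` for `S ∈ FP`. [folklore] -/
theorem seBody_mem_FP (c : ℕ) {S : List Bool → List Bool} (hS : S ∈ FP) : seBody c S ∈ FP := by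
  have hSA : (S ∘ seArg) ∈ FP := comp_mem_FP hS seArg_mem_FP
  exact iteFn_mem_FP (comp_mem_FP headBitFn_mem_FP (nthF_mem_FP 2)) seKeep_mem_FP
    (fanoutFn_mem_FP (comp_mem_FP headBitFn_mem_FP (comp_mem_FP fstF_mem_FP hSA))
      (fanoutFn_mem_FP (clipF_mem_FP c (comp_mem_FP sndF_mem_FP hSA))
        (fanoutFn_mem_FP (nthF_mem_FP 4) (fanoutFn_mem_FP (nthF_mem_FP 5) (sndPow_mem_FP 5)))))

/-- **`searchS c mt As ∈ FP`** for a matcher `mt ∈ FP`. [folklore] -/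
theorem searchS_mem_FP (c : ℕ) {mt : List Bool → List Bool} (hmt : mt ∈ FP) :
    ∀ As : List (PropForm ℕ), searchS c mt As ∈ FP
  | [] => hmt
  | _ :: As => comp_mem_FP (fanoutFn_mem_FP (nthF_mem_FP 2) (nthF_mem_FP 3))
      (comp_mem_FP (feLoop_mem_FP _ (seBody_mem_FP c (searchS_mem_FP c hmt As))
        (foldGrowth_seBody c _)) seIn_mem_FP)

/-! ### Specification of the search -/

/-- **The search, specified**: `m x θ ℓs` is the meaning of the matcher on the candidate
`(θ, ℓs)` (`none` = no match); premises still to be chosen range over the earlier lines `Es`,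
the first success in the lexicographic enumeration wins (`List.findSome?`). [folklore] -/
def specSearch (m : List Bool → PropForm ℕ → List (PropForm ℕ) → Option (List Bool)) (x : List Bool)
    (Es : List (PropForm ℕ)) : List (PropForm ℕ) → PropForm ℕ → List (PropForm ℕ) → Option (List Bool)
  | [], θ, ℓs => m x θ ℓs
  | _ :: As, θ, ℓs => Es.findSome? fun e => specSearch m x Es As θ (ℓs ++ [e])

/-- A value found by `findSome?` is a value of the function. [folklore] -/
theorem exists_of_findSome?_eq_some {α β : Type} {f : α → Option β} {l : List α} {b : β}
    (h : l.findSome? f = some b) : ∃ a ∈ l, f a = some b := by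
  induction l with
  | nil => simp at h
  | cons a l ih =>
    rw [List.findSome?_cons] at h
    cases hfa : f a with
    | some b' => rw [hfa] at h; cases h; exact ⟨a, by simp, hfa⟩
    | none => rw [hfa] at h; obtain ⟨a', ha', h'⟩ := ih h; exact ⟨a', by simp [ha'], h'⟩

/-- The values of the specified search obey the cap of the matcher. [folklore] -/
theorem length_specSearch_le {m : List Bool → PropForm ℕ → List (PropForm ℕ) → Option (List Bool)}
    {c : ℕ} (hm : ∀ x θ ℓs b, m x θ ℓs = some b → b.length ≤ c * (x.length + 1)) (x : List Bool)
    (Es : List (PropForm ℕ)) : ∀ (As : List (PropForm ℕ)) (θ : PropForm ℕ) (ℓs : List (PropForm ℕ))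
      (b : List Bool), specSearch m x Es As θ ℓs = some b → b.length ≤ c * (x.length + 1)
  | [], θ, ℓs, b, h => hm x θ ℓs b h
  | _ :: As, θ, ℓs, b, h => by
    obtain ⟨e, _, he⟩ := exists_of_findSome?_eq_some h
    exact length_specSearch_le hm x Es As θ _ b he

/-- `seIn` on an input record. [folklore] -/
theorem seIn_rec4 (x E θc pre : List Bool) :
    seIn (rec4 x E θc pre) = boolPair x (boolPair E (seSt [false] [] E θc pre)) := by
  simp [seIn, rec4, seSt]

/-- The stream of one more chosen premise. [folklore] -/
theorem preOf_map_append_singleton (ℓs : List (PropForm ℕ)) (e : PropForm ℕ) :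
    preOf (ℓs.map PropForm.code) ++ true :: true :: false :: e.code =
      preOf ((ℓs ++ [e]).map PropForm.code) := by
  rw [List.map_append, preOf_append]; simp [preOf]

/-- A search level latches: once the flag is set, the fold is constant. [folklore] -/
theorem foldl_seBody_latch (c : ℕ) (S : List Bool → List Bool) (x b E θc pre : List Bool) :
    ∀ l : List (List Bool),
      l.foldl (fun st a => seBody c S (boolPair x (boolPair a st))) (seSt [true] b E θc pre) =
        seSt [true] b E θc pre
  | [] => rfl
  | a :: l => by
    rw [List.foldl_cons, seBody_rec]
    exact foldl_seBody_latch c S x b E θc pre l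

/-- **Correctness of `searchS` relative to its matcher.** If on genuine codes the matcher `mt`
reports `(m x θ ℓs).isSome` in its flag and the value in its result, with values within the cap
`c(|x| + 1)`, then so does `searchS c mt As` for `specSearch m x Es As`, on records whose list of
earlier lines `Es` has at most `|x|` members. [folklore] -/
theorem searchS_spec {c : ℕ} {mt : List Bool → List Bool}
    {m : List Bool → PropForm ℕ → List (PropForm ℕ) → Option (List Bool)}
    (hmt₁ : ∀ (x E : List Bool) (θ : PropForm ℕ) (ℓs : List (PropForm ℕ)),
      fstF (mt (rec4 x E θ.code (preOf (ℓs.map PropForm.code)))) = [(m x θ ℓs).isSome])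
    (hmt₂ : ∀ (x E : List Bool) (θ : PropForm ℕ) (ℓs : List (PropForm ℕ)) (b : List Bool),
      m x θ ℓs = some b → sndF (mt (rec4 x E θ.code (preOf (ℓs.map PropForm.code)))) = b)
    (hm : ∀ x θ ℓs b, m x θ ℓs = some b → b.length ≤ c * (x.length + 1))
    (x : List Bool) (Es : List (PropForm ℕ)) (hEs : Es.length ≤ x.length) :
    ∀ (As : List (PropForm ℕ)) (θ : PropForm ℕ) (ℓs : List (PropForm ℕ)),
      fstF (searchS c mt As (rec4 x (encList (Es.map PropForm.code)) θ.code (preOf (ℓs.map PropForm.code))))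
          = [(specSearch m x Es As θ ℓs).isSome] ∧
        ∀ b, specSearch m x Es As θ ℓs = some b →
          sndF (searchS c mt As (rec4 x (encList (Es.map PropForm.code)) θ.code
            (preOf (ℓs.map PropForm.code)))) = b
  | [], θ, ℓs => ⟨hmt₁ x _ θ ℓs, fun b hb => hmt₂ x _ θ ℓs b hb⟩
  | A :: As, θ, ℓs => by
    set E := encList (Es.map PropForm.code) with hE
    set S := searchS c mt As with hS
    set F : PropForm ℕ → Option (List Bool) := fun e => specSearch m x Es As θ (ℓs ++ [e]) with hF
    -- the fold of the body over the earlier lines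
    have key : ∀ (es : List (PropForm ℕ)) (junk : List Bool), ∃ junk' : List Bool,
        (es.map PropForm.code).foldl (fun st a => seBody c S (boolPair x (boolPair a st)))
            (seSt [false] junk E θ.code (preOf (ℓs.map PropForm.code))) =
          match es.findSome? F with
          | some b => seSt [true] b E θ.code (preOf (ℓs.map PropForm.code))
          | none => seSt [false] junk' E θ.code (preOf (ℓs.map PropForm.code)) := by
      intro es
      induction es with
      | nil => intro junk; exact ⟨junk, rfl⟩
      | cons e es ih =>
        intro junk
        rw [List.map_cons, List.foldl_cons, seBody_rec, List.findSome?_cons]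
        simp only [List.headD_cons, Bool.false_eq_true, if_false]
        rw [preOf_map_append_singleton]
        obtain ⟨h₁, h₂⟩ := searchS_spec hmt₁ hmt₂ hm x Es hEs As θ (ℓs ++ [e])
        rw [← hS, ← hE] at h₁ h₂
        rw [h₁]
        simp only [List.headD_cons]
        cases hFe : F e with
        | none =>
          have : (specSearch m x Es As θ (ℓs ++ [e])).isSome = false := by
            rw [show specSearch m x Es As θ (ℓs ++ [e]) = F e from rfl, hFe]; rfl
          rw [this]
          exact ih _
        | some b =>
          have hval : specSearch m x Es As θ (ℓs ++ [e]) = some b := hFe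
          rw [show (specSearch m x Es As θ (ℓs ++ [e])).isSome = true by rw [hval]; rfl, h₂ b hval,
            List.take_of_length_le (length_specSearch_le hm x Es As θ _ b hval)]
          exact ⟨junk, foldl_seBody_latch c S x b E _ _ _⟩
    obtain ⟨junk', hfold⟩ := key Es []
    have hloop : (seOut ∘ feLoop Polynomial.X (seBody c S) ∘ seIn)
        (rec4 x E θ.code (preOf (ℓs.map PropForm.code))) =
        boolPair (nthF 0 ((Es.map PropForm.code).foldl
          (fun st a => seBody c S (boolPair x (boolPair a st))) (seSt [false] [] E θ.code
            (preOf (ℓs.map PropForm.code)))))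
        (nthF 1 ((Es.map PropForm.code).foldl
          (fun st a => seBody c S (boolPair x (boolPair a st))) (seSt [false] [] E θ.code
            (preOf (ℓs.map PropForm.code))))) := by
      simp only [Function.comp_apply, seIn_rec4]
      rw [hE, feLoop_rec _ _ _ _ _ (by simpa using hEs), ← hE]
      simp [seOut]
    simp only [searchS, ← hS]
    rw [hloop, hfold]
    constructor
    · change _ = [(Es.findSome? F).isSome]
      cases Es.findSome? F <;> simp [seSt]
    · intro b hb
      change Es.findSome? F = some b at hb
      rw [hb]
      simp [seSt]

/-! ### The matcher as an instance of the search specification -/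

/-- The meaning of the matcher of the rule `r` (derivation `Dr`, cap `c`): the capped coded
block if the candidate matches. [folklore] -/
def mOf (r : FregeRule) (Dr : List (PropForm ℕ)) (c : ℕ) (x : List Bool) (θ : PropForm ℕ)
    (ℓs : List (PropForm ℕ)) : Option (List Bool) :=
  if matchOkM r θ.code (preOf (ℓs.map PropForm.code)) then
    some ((matchBlkM r Dr θ.code (preOf (ℓs.map PropForm.code))).take (c * (x.length + 1)))
  else none

/-- The matcher reports `mOf` (flag). [folklore] -/
theorem fstF_matchS (r : FregeRule) (Dr : List (PropForm ℕ)) (c : ℕ) (x E : List Bool) (θ : PropForm ℕ)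
    (ℓs : List (PropForm ℕ)) :
    fstF (matchS r Dr c (rec4 x E θ.code (preOf (ℓs.map PropForm.code)))) = [(mOf r Dr c x θ ℓs).isSome] := by
  rw [matchS_apply]
  simp only [rec4, mOf]
  split <;> simp_all

/-- The matcher reports `mOf` (value). [folklore] -/
theorem sndF_matchS (r : FregeRule) (Dr : List (PropForm ℕ)) (c : ℕ) (x E : List Bool) (θ : PropForm ℕ)
    (ℓs : List (PropForm ℕ)) (b : List Bool) (h : mOf r Dr c x θ ℓs = some b) :
    sndF (matchS r Dr c (rec4 x E θ.code (preOf (ℓs.map PropForm.code)))) = b := by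
  rw [matchS_apply]
  simp only [rec4, mOf] at h ⊢
  split at h <;> simp_all

/-- The values of `mOf` obey the cap. [folklore] -/
theorem length_mOf_le (r : FregeRule) (Dr : List (PropForm ℕ)) (c : ℕ) (x : List Bool) (θ : PropForm ℕ)
    (ℓs : List (PropForm ℕ)) (b : List Bool) (h : mOf r Dr c x θ ℓs = some b) :
    b.length ≤ c * (x.length + 1) := by
  simp only [mOf] at h
  split at h
  · cases h; simp
  · cases h

/-! ### The cascade over the rules -/

/-- The search of the rule `r`: table of `F₁`-derivations `D`, cap constants `cc`. [folklore] -/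
noncomputable def ruleS (D : FregeRule → List (PropForm ℕ)) (cc : FregeRule → ℕ) (r : FregeRule) :
    List Bool → List Bool :=
  searchS (cc r) (matchS r (D r) (cc r)) r.premises

/-- **The cascade**: the first rule (in the order of the list) whose search succeeds.
[cite: CookReckhow1979, Thm. 2.3 (proof)] -/
noncomputable def cascS (D : FregeRule → List (PropForm ℕ)) (cc : FregeRule → ℕ) :
    List FregeRule → (List Bool → List Bool)
  | [] => fun _ => boolPair [false] []
  | r :: rs => iteFn (headBitFn ∘ fstF ∘ ruleS D cc r) (ruleS D cc r) (cascS D cc rs)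

/-- `ruleS D cc r ∈ FP`. [folklore] -/
theorem ruleS_mem_FP (D : FregeRule → List (PropForm ℕ)) (cc : FregeRule → ℕ) (r : FregeRule) :
    ruleS D cc r ∈ FP :=
  searchS_mem_FP _ (matchS_mem_FP _ _ _) _

/-- `cascS D cc rs ∈ FP`. [folklore] -/
theorem cascS_mem_FP (D : FregeRule → List (PropForm ℕ)) (cc : FregeRule → ℕ) :
    ∀ rs : List FregeRule, cascS D cc rs ∈ FP
  | [] => const_mem_FP _
  | r :: rs => iteFn_mem_FP (comp_mem_FP headBitFn_mem_FP (comp_mem_FP fstF_mem_FP (ruleS_mem_FP D cc r)))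
      (ruleS_mem_FP D cc r) (cascS_mem_FP D cc rs)

/-- The specified search of the rule `r` from the empty tuple. [folklore] -/
def specR (D : FregeRule → List (PropForm ℕ)) (cc : FregeRule → ℕ) (r : FregeRule) (x : List Bool)
    (Es : List (PropForm ℕ)) (θ : PropForm ℕ) : Option (List Bool) :=
  specSearch (mOf r (D r) (cc r)) x Es r.premises θ []

/-- The specified cascade. [folklore] -/
def specCasc (D : FregeRule → List (PropForm ℕ)) (cc : FregeRule → ℕ) (rs : List FregeRule) (x : List Bool)
    (Es : List (PropForm ℕ)) (θ : PropForm ℕ) : Option (List Bool) :=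
  rs.findSome? fun r => specR D cc r x Es θ

/-- **Correctness of the cascade** on genuine codes (`|Es| ≤ |x|`): the flag is
`(specCasc …).isSome` and the result is its value, `[]` if none. [folklore] -/
theorem cascS_spec (D : FregeRule → List (PropForm ℕ)) (cc : FregeRule → ℕ) (x : List Bool)
    (Es : List (PropForm ℕ)) (hEs : Es.length ≤ x.length) (θ : PropForm ℕ) :
    ∀ rs : List FregeRule,
      fstF (cascS D cc rs (rec4 x (encList (Es.map PropForm.code)) θ.code [])) =
          [(specCasc D cc rs x Es θ).isSome] ∧
        sndF (cascS D cc rs (rec4 x (encList (Es.map PropForm.code)) θ.code [])) =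
          (specCasc D cc rs x Es θ).getD []
  | [] => by simp [cascS, specCasc]
  | r :: rs => by
    have hr := searchS_spec (c := cc r) (mt := matchS r (D r) (cc r)) (m := mOf r (D r) (cc r))
      (fun x E θ ℓs => fstF_matchS r (D r) (cc r) x E θ ℓs)
      (fun x E θ ℓs b hb => sndF_matchS r (D r) (cc r) x E θ ℓs b hb)
      (fun x θ ℓs b hb => length_mOf_le r (D r) (cc r) x θ ℓs b hb) x Es hEs r.premises θ []
    simp only [List.map_nil, preOf] at hr
    obtain ⟨h₁, h₂⟩ := hr
    have hc : (headBitFn ∘ fstF ∘ ruleS D cc r) (rec4 x (encList (Es.map PropForm.code)) θ.code []) =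
        [(specR D cc r x Es θ).isSome] := by
      simp only [Function.comp_apply, ruleS, h₁, headBitFn_apply, specR]; rfl
    obtain ⟨ih₁, ih₂⟩ := cascS_spec D cc x Es hEs θ rs
    rw [cascS, iteFn_apply hc, specCasc, List.findSome?_cons]
    cases hR : specR D cc r x Es θ with
    | none =>
      simp only [Option.isSome_none, Bool.false_eq_true, if_false]
      exact ⟨ih₁, ih₂⟩
    | some b =>
      simp only [Option.isSome_some, if_true, Option.getD_some]
      refine ⟨?_, ?_⟩
      · rw [ruleS, h₁]
        change [(specR D cc r x Es θ).isSome] = [true]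
        rw [hR]; rfl
      · rw [ruleS]; exact h₂ b hR

/-! ### The outer loop over the lines of the proof, and the assembled translation -/

/-- The argument of the cascade from an outer body record `⟨x, ⟨item, ⟨E, out⟩⟩⟩` (the item is
the code word `⟨1^{size}, code θ⟩` of the current line): `⟨x, ⟨E, ⟨code θ, []⟩⟩⟩`. [folklore] -/
noncomputable def outArg : List Bool → List Bool :=
  fanoutFn fstF (fanoutFn (nthF 2) (fanoutFn (sndF ∘ nthF 1) (fun _ => [])))

/-- **The body of the outer loop**: append the code of the current line to the earlier lines and
the (clipped) block found by the cascade to the output ("simply replace `B_i` by the derivation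
`σ_i(π_{R_i})`"). [cite: CookReckhow1979, Thm. 2.3 (proof)] -/
noncomputable def outBody (D : FregeRule → List (PropForm ℕ)) (cc : FregeRule → ℕ) (rs : List FregeRule)
    (K : ℕ) : List Bool → List Bool :=
  fanoutFn (appendFn ∘ fanoutFn (nthF 2) (fanoutFn (sndF ∘ nthF 1) (fun _ => [])))
    (appendFn ∘ fanoutFn (sndPow 2) (clipF K (sndF ∘ cascS D cc rs ∘ outArg)))

/-- `outBody` on a body record. [folklore] -/
theorem outBody_rec (D : FregeRule → List (PropForm ℕ)) (cc : FregeRule → ℕ) (rs : List FregeRule) (K : ℕ)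
    (x item E out : List Bool) :
    outBody D cc rs K (boolPair x (boolPair item (boolPair E out))) =
      boolPair (E ++ boolPair (sndF item) [])
        (out ++ (sndF (cascS D cc rs (rec4 x E (sndF item) []))).take (K * (x.length + 1))) := by
  simp [outBody, outArg, rec4, clipF_apply]

/-- Growth of the outer body (`Brick.FoldGrowth`, on every word). [folklore] -/
theorem foldGrowth_outBody (D : FregeRule → List (PropForm ℕ)) (cc : FregeRule → ℕ) (rs : List FregeRule)
    (K : ℕ) : FoldGrowth (K + 6) (outBody D cc rs K) := by
  intro z
  have e1 : nthF 1 z = fstF (sndF z) := rfl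
  have e2 : nthF 2 z = fstF (sndF (sndF z)) := rfl
  have e3 : sndPow 2 z = sndF (sndF (sndF z)) := rfl
  have h0 := length_fstF_sndF_le (sndF (sndF z))
  have h1 := length_fstF_sndF_le (fstF (sndF z))
  have hclip := length_clipF_le K (sndF ∘ cascS D cc rs ∘ outArg) z
  simp only [outBody, fanoutFn_apply, Function.comp_apply, length_boolPair, List.length_append,
    e1, e2, e3, appendFn_boolPair, List.length_nil] at hclip ⊢
  nlinarith

/-- `outBody D cc rs K ∈ FP`. [folklore] -/
theorem outBody_mem_FP (D : FregeRule → List (PropForm ℕ)) (cc : FregeRule → ℕ) (rs : List FregeRule) (K : ℕ) :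
    outBody D cc rs K ∈ FP :=
  fanoutFn_mem_FP (comp_mem_FP appendFn_mem_FP (fanoutFn_mem_FP (nthF_mem_FP 2)
      (fanoutFn_mem_FP (comp_mem_FP sndF_mem_FP (nthF_mem_FP 1)) (const_mem_FP _))))
    (comp_mem_FP appendFn_mem_FP (fanoutFn_mem_FP (sndPow_mem_FP 2) (clipF_mem_FP K
      (comp_mem_FP sndF_mem_FP (comp_mem_FP (cascS_mem_FP D cc rs) (fanoutFn_mem_FP fstF_mem_FP
        (fanoutFn_mem_FP (nthF_mem_FP 2) (fanoutFn_mem_FP (comp_mem_FP sndF_mem_FP (nthF_mem_FP 1))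
          (const_mem_FP _)))))))))

/-- The initial outer record `⟨z, ⟨chain of the code words of z, ⟨[], []⟩⟩⟩`. [folklore] -/
noncomputable def trInit : List Bool → List Bool :=
  fanoutFn id (fanoutFn sndF (fun _ => boolPair [] []))

/-- The body of the counting loop: one unary digit per item. [folklore] -/
def lenG : List Bool → List Bool := List.cons true ∘ sndPow 1

/-- The final packaging `⟨1^{#lines}, chain of code words⟩` of the outer record (the list code
`Encoding.listBool`). `M |x|` bounds the number of output lines. [folklore] -/
noncomputable def trFinal (M : ℕ) : List Bool → List Bool :=
  fanoutFn (sndPow 1 ∘ feLoop (Polynomial.C M * Polynomial.X) lenG ∘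
      fanoutFn fstF (fanoutFn (sndPow 2) (fun _ => [])))
    (sndPow 2)

/-- **The translation as a string function**: initialise, run the outer loop over the lines,
package (the function `f ∈ 𝓛` of the theorem). [cite: CookReckhow1979, Thm. 2.3] -/
noncomputable def translS (D : FregeRule → List (PropForm ℕ)) (cc : FregeRule → ℕ) (rs : List FregeRule)
    (K M : ℕ) : List Bool → List Bool :=
  trFinal M ∘ feLoop Polynomial.X (outBody D cc rs K) ∘ trInit

/-- **`translS ∈ FP`**: the translation is polynomial-time computable ("there is a function `f`
in `𝓛`"). [cite: CookReckhow1979, Thm. 2.3] -/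
theorem translS_mem_FP (D : FregeRule → List (PropForm ℕ)) (cc : FregeRule → ℕ) (rs : List FregeRule)
    (K M : ℕ) : translS D cc rs K M ∈ FP := by
  have hlen : feLoop (Polynomial.C M * Polynomial.X) lenG ∈ FP :=
    feLoop_mem_FP _ (comp_mem_FP (cons_mem_FP _) (sndPow_mem_FP 1)) (c := 1)
      (fun v => by simp [lenG, sndPow]; omega)
  refine comp_mem_FP ?_ (comp_mem_FP (feLoop_mem_FP _ (outBody_mem_FP D cc rs K)
    (foldGrowth_outBody D cc rs K)) (fanoutFn_mem_FP OracleCompose.id_mem_FP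
      (fanoutFn_mem_FP sndF_mem_FP (const_mem_FP _))))
  exact fanoutFn_mem_FP (comp_mem_FP (sndPow_mem_FP 1) (comp_mem_FP hlen (fanoutFn_mem_FP fstF_mem_FP
    (fanoutFn_mem_FP (sndPow_mem_FP 2) (const_mem_FP _))))) (sndPow_mem_FP 2)



/-! ### The translation specified at the level of formulas -/

/-- `(l.findSome? f).map g = l.findSome? (g <$> f ·)`. [folklore] -/
theorem findSome?_map_comm {α β γ : Type} (f : α → Option β) (g : β → γ) :
    ∀ l : List α, (l.findSome? f).map g = l.findSome? fun a => (f a).map g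
  | [] => rfl
  | a :: l => by
    rw [List.findSome?_cons, List.findSome?_cons]
    cases f a with
    | some b => rfl
    | none => exact findSome?_map_comm f g l

/-- **The tuple search at the level of formulas**: the first tuple `ℓs ++ tail`, `tail` drawn from
the earlier lines `Es` (one entry per remaining premise, lexicographically), matching the rule.
[folklore] -/
def tupleSearch (r : FregeRule) (Es : List (PropForm ℕ)) :
    List (PropForm ℕ) → PropForm ℕ → List (PropForm ℕ) → Option (List (PropForm ℕ))
  | [], θ, ℓs => if matchOkM r θ.code (preOf (ℓs.map PropForm.code)) then some ℓs else none
  | _ :: As, θ, ℓs => Es.findSome? fun e => tupleSearch r Es As θ (ℓs ++ [e])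

/-- The coded search is the formula-level search followed by emission. [folklore] -/
theorem specSearch_mOf (r : FregeRule) (Dr : List (PropForm ℕ)) (c : ℕ) (x : List Bool) (Es : List (PropForm ℕ)) :
    ∀ (As : List (PropForm ℕ)) (θ : PropForm ℕ) (ℓs : List (PropForm ℕ)),
      specSearch (mOf r Dr c) x Es As θ ℓs = (tupleSearch r Es As θ ℓs).map fun ℓs' =>
        (matchBlkM r Dr θ.code (preOf (ℓs'.map PropForm.code))).take (c * (x.length + 1))
  | [], θ, ℓs => by simp only [specSearch, mOf, tupleSearch]; split <;> rfl
  | _ :: As, θ, ℓs => by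
    rw [specSearch, tupleSearch, findSome?_map_comm]
    congr 1
    funext e
    exact specSearch_mOf r Dr c x Es As θ _

/-- **Soundness of the tuple search**: a found tuple extends the given one by earlier lines and
matches. [folklore] -/
theorem tupleSearch_sound (r : FregeRule) (Es : List (PropForm ℕ)) :
    ∀ (As : List (PropForm ℕ)) (θ : PropForm ℕ) (ℓs ℓs' : List (PropForm ℕ)),
      tupleSearch r Es As θ ℓs = some ℓs' →
        ∃ tail : List (PropForm ℕ), ℓs' = ℓs ++ tail ∧ (∀ e ∈ tail, e ∈ Es) ∧
          matchOkM r θ.code (preOf (ℓs'.map PropForm.code)) = true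
  | [], θ, ℓs, ℓs', h => by
    simp only [tupleSearch] at h
    split at h
    · cases h; exact ⟨[], by simp, by simp, by assumption⟩
    · cases h
  | _ :: As, θ, ℓs, ℓs', h => by
    obtain ⟨e, he, h'⟩ := exists_of_findSome?_eq_some h
    obtain ⟨tail, rfl, htail, hok⟩ := tupleSearch_sound r Es As θ _ _ h'
    exact ⟨e :: tail, by simp, fun e' he' => by
      rcases List.mem_cons.1 he' with rfl | h'' <;> [exact he; exact htail e' h''], hok⟩

/-- `findSome?` succeeds if the function succeeds on some member. [folklore] -/
theorem isSome_findSome?_of_mem {α β : Type} {f : α → Option β} {l : List α} {a : α} (ha : a ∈ l)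
    (h : (f a).isSome = true) : (l.findSome? f).isSome = true := by
  induction l with
  | nil => simp at ha
  | cons a' l ih =>
    rw [List.findSome?_cons]
    cases hfa : f a' with
    | some b => rfl
    | none =>
      rcases List.mem_cons.1 ha with rfl | ha'
      · rw [hfa] at h; simp at h
      · exact ih ha'

/-- **Completeness of the tuple search**: if some extension by earlier lines matches, the search
succeeds. [folklore] -/
theorem tupleSearch_complete (r : FregeRule) (Es : List (PropForm ℕ)) :
    ∀ (As : List (PropForm ℕ)) (θ : PropForm ℕ) (ℓs tail : List (PropForm ℕ)),
      tail.length = As.length → (∀ e ∈ tail, e ∈ Es) →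
        matchOkM r θ.code (preOf ((ℓs ++ tail).map PropForm.code)) = true →
          (tupleSearch r Es As θ ℓs).isSome = true
  | [], θ, ℓs, tail, hlen, _, hok => by
    cases tail with
    | nil => simp only [List.append_nil] at hok; simp [tupleSearch, hok]
    | cons _ _ => simp at hlen
  | _ :: As, θ, ℓs, tail, hlen, htail, hok => by
    cases tail with
    | nil => simp at hlen
    | cons e tail =>
      rw [tupleSearch]
      refine isSome_findSome?_of_mem (htail e (by simp)) ?_
      refine tupleSearch_complete r Es As θ (ℓs ++ [e]) tail (by simpa using hlen)
        (fun e' he' => htail e' (by simp [he'])) ?_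
      simpa using hok

/-- The matching substitution of a found tuple (the `σ_i` of the printed proof).
[cite: CookReckhow1979, Thm. 2.3 (proof)] -/
def σOf (r : FregeRule) (θ : PropForm ℕ) (ℓs : List (PropForm ℕ)) : ℕ → PropForm ℕ :=
  substOf (varSeq (rulePat r)) (binds (rulePat r) (bigConj (θ :: ℓs)))

/-- **The block of a line at the level of formulas**: `σ'(D r)` for the first rule `r` and tuple
of earlier lines matching, `[]` if none (the replacement `σ_i(π_{R_i})` of the line `B_i`).
[cite: CookReckhow1979, Thm. 2.3 (proof)] -/
def lineForms (D : FregeRule → List (PropForm ℕ)) (rs : List FregeRule) (Es : List (PropForm ℕ))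
    (θ : PropForm ℕ) : List (PropForm ℕ) :=
  (rs.findSome? fun r => (tupleSearch r Es r.premises θ []).map fun ℓs =>
    (D r).map (PropForm.subst (σOf r θ ℓs))).getD []

/-- The translation with its list of lines read so far. [folklore] -/
def translAux (D : FregeRule → List (PropForm ℕ)) (rs : List FregeRule) (π : List (PropForm ℕ)) :
    List (PropForm ℕ) × List (PropForm ℕ) :=
  π.foldl (fun p θ => (p.1 ++ [θ], p.2 ++ lineForms D rs p.1 θ)) ([], [])

/-- **The translation at the level of formulas**: the concatenation of the blocks of the lines
(the `f(π)` of the theorem). [cite: CookReckhow1979, Thm. 2.3] -/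
def translForms (D : FregeRule → List (PropForm ℕ)) (rs : List FregeRule) (π : List (PropForm ℕ)) :
    List (PropForm ℕ) :=
  (translAux D rs π).2

/-- The first component of `translAux` is the list read. [folklore] -/
theorem translAux_fst (D : FregeRule → List (PropForm ℕ)) (rs : List FregeRule) (π : List (PropForm ℕ)) :
    (translAux D rs π).1 = π := by
  suffices h : ∀ (p : List (PropForm ℕ) × List (PropForm ℕ)),
      (π.foldl (fun p θ => (p.1 ++ [θ], p.2 ++ lineForms D rs p.1 θ)) p).1 = p.1 ++ π by
    simpa [translAux] using h ([], [])
  induction π with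
  | nil => intro p; simp
  | cons θ π ih => intro p; rw [List.foldl_cons, ih]; simp

/-- `translForms [] = []`. [folklore] -/
@[simp] theorem translForms_nil (D : FregeRule → List (PropForm ℕ)) (rs : List FregeRule) :
    translForms D rs [] = [] := rfl

/-- **One more line**: `f(π · θ) = f(π) · block(π, θ)`. [folklore] -/
theorem translForms_append_singleton (D : FregeRule → List (PropForm ℕ)) (rs : List FregeRule)
    (π : List (PropForm ℕ)) (θ : PropForm ℕ) :
    translForms D rs (π ++ [θ]) = translForms D rs π ++ lineForms D rs π θ := by
  have h := translAux_fst D rs π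
  simp only [translForms, translAux, List.foldl_append, List.foldl_cons, List.foldl_nil] at h ⊢
  rw [h]

/-- A successful cascade yields the block `σ(D r)` of a rule `r` of the list and a substitution
`σ` with `r.conclusion σ = θ` and all `r.premises σ` among `Es`. [cite: CookReckhow1979, Thm. 2.3 (proof)]
[cite: CookReckhow1979, Lemma 2.5] -/
theorem lineForms_of_findSome?_eq_some (D : FregeRule → List (PropForm ℕ)) (rs : List FregeRule)
    (Es : List (PropForm ℕ)) (θ : PropForm ℕ) {B : List (PropForm ℕ)}
    (h : (rs.findSome? fun r => (tupleSearch r Es r.premises θ []).map fun ℓs =>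
      (D r).map (PropForm.subst (σOf r θ ℓs))) = some B) :
    ∃ r ∈ rs, ∃ σ : ℕ → PropForm ℕ, r.conclusion.subst σ = θ ∧
      (∀ p ∈ r.premises, p.subst σ ∈ Es) ∧ lineForms D rs Es θ = (D r).map (PropForm.subst σ) := by
  have hval : lineForms D rs Es θ = B := by unfold lineForms; rw [h]; rfl
  obtain ⟨r, hr, hB⟩ := exists_of_findSome?_eq_some h
  cases ht : tupleSearch r Es r.premises θ [] with
  | none => rw [ht] at hB; cases hB
  | some ℓs =>
    rw [ht] at hB
    cases hB
    obtain ⟨tail, htl, htail, hok⟩ := tupleSearch_sound r Es r.premises θ [] ℓs ht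
    simp only [List.nil_append] at htl
    subst htl
    obtain ⟨hc, hp, -⟩ := matchOkM_sound hok (D r)
    refine ⟨r, hr, σOf r θ ℓs, hc, fun p hpr => ?_, hval⟩
    have : p.subst (σOf r θ ℓs) ∈ r.premises.map (PropForm.subst (σOf r θ ℓs)) :=
      List.mem_map_of_mem hpr
    rw [σOf] at this ⊢
    rw [hp] at this
    exact htail _ this

/-- **What a block is** (soundness): the block of `θ` after the earlier lines `Es` is empty, or it
is `σ(D r)` for a rule `r` of the list and a substitution `σ` with `r.conclusion σ = θ` and all
`r.premises σ` among `Es`. [cite: CookReckhow1979, Thm. 2.3 (proof)] [cite: CookReckhow1979, Lemma 2.5] -/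
theorem lineForms_cases (D : FregeRule → List (PropForm ℕ)) (rs : List FregeRule) (Es : List (PropForm ℕ))
    (θ : PropForm ℕ) :
    lineForms D rs Es θ = [] ∨
      ∃ r ∈ rs, ∃ σ : ℕ → PropForm ℕ, r.conclusion.subst σ = θ ∧
        (∀ p ∈ r.premises, p.subst σ ∈ Es) ∧ lineForms D rs Es θ = (D r).map (PropForm.subst σ) := by
  cases h : rs.findSome? (fun r => (tupleSearch r Es r.premises θ []).map fun ℓs =>
      (D r).map (PropForm.subst (σOf r θ ℓs))) with
  | none => left; unfold lineForms; rw [h]; rfl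
  | some B => exact Or.inr (lineForms_of_findSome?_eq_some D rs Es θ h)

/-- **When a block is found** (completeness): if `θ` is an instance of the conclusion of a rule of
the list with premise instances among `Es`, then its block is `σ(D r)` for such a rule `r` and
substitution `σ`. [cite: CookReckhow1979, Thm. 2.3 (proof)] -/
theorem lineForms_of_inferred (D : FregeRule → List (PropForm ℕ)) (rs : List FregeRule) (Es : List (PropForm ℕ))
    (θ : PropForm ℕ) (h : ∃ r ∈ rs, ∃ σ : ℕ → PropForm ℕ, r.conclusion.subst σ = θ ∧ ∀ p ∈ r.premises, p.subst σ ∈ Es) :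
    ∃ r ∈ rs, ∃ σ : ℕ → PropForm ℕ, r.conclusion.subst σ = θ ∧
      (∀ p ∈ r.premises, p.subst σ ∈ Es) ∧ lineForms D rs Es θ = (D r).map (PropForm.subst σ) := by
  obtain ⟨r, hr, σ, hc, hp⟩ := h
  have hsome : (rs.findSome? fun r => (tupleSearch r Es r.premises θ []).map fun ℓs =>
      (D r).map (PropForm.subst (σOf r θ ℓs))).isSome = true := by
    refine isSome_findSome?_of_mem hr ?_
    rw [Option.isSome_map]
    refine tupleSearch_complete r Es r.premises θ [] (r.premises.map (PropForm.subst σ)) (by simp)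
      (fun e he => ?_) ?_
    · obtain ⟨p, hp', rfl⟩ := List.mem_map.1 he; exact hp p hp'
    · simpa [← hc] using matchOkM_complete r σ
  obtain ⟨B, hB⟩ := Option.isSome_iff_exists.1 hsome
  exact lineForms_of_findSome?_eq_some D rs Es θ hB



/-! ### Size of the emitted blocks (the cap is a no-op on genuine data) -/

/-- Bindings of a fitting conjunction chain are subformulas of its conjuncts. [folklore] -/
theorem binds_bigConj_bound (L : ℕ) : ∀ (ps φs : List (PropForm ℕ)),
    fits (bigConj ps) (bigConj φs) = true → (∀ φ ∈ φs, φ.code.length ≤ L) →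
      ∀ χ ∈ binds (bigConj ps) (bigConj φs), χ.code.length ≤ L
  | [], φs, _, _ => by simp [bigConj, binds]
  | p :: ps, [], h, _ => by simp [bigConj, fits] at h
  | p :: ps, φ :: φs, h, hφ => by
    simp only [bigConj, fits, Bool.and_eq_true] at h
    intro χ hχ
    simp only [bigConj, binds, List.mem_append] at hχ
    rcases hχ with hχ | hχ
    · exact (length_code_le_of_mem_binds p φ χ hχ).trans (hφ φ (by simp))
    · exact binds_bigConj_bound L ps φs h.2 (fun φ' h' => hφ φ' (by simp [h'])) χ hχ

/-- The code of a substituted formula: `|code (ℓ τ)| ≤ |ℓ| · K` if every value of `τ` has code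
length at most `K ≥ 3`. [Cook–Reckhow 1979, §2, proof of Thm. 2.3 (`ρ(f(π)) ≤ c ρ(π)`)] [folklore] -/
theorem length_code_subst_le (τ : ℕ → PropForm ℕ) (K : ℕ) (hK : 3 ≤ K) (hτ : ∀ y, (τ y).code.length ≤ K) :
    ∀ ℓ : PropForm ℕ, (ℓ.subst τ).code.length ≤ ℓ.size * K
  | .var y => by simpa [PropForm.subst, PropForm.size] using hτ y
  | .const b => by simpa [PropForm.subst, PropForm.size, PropForm.code] using hK
  | .neg ℓ => by
    have := length_code_subst_le τ K hK hτ ℓ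
    simp only [PropForm.subst, PropForm.code, List.length_cons, PropForm.size, Nat.add_mul, one_mul]
    omega
  | .conj ℓ₁ ℓ₂ => by
    have h₁ := length_code_subst_le τ K hK hτ ℓ₁
    have h₂ := length_code_subst_le τ K hK hτ ℓ₂
    simp only [PropForm.subst, PropForm.code, List.length_cons, List.length_append, PropForm.size,
      Nat.add_mul, one_mul]
    omega
  | .disj ℓ₁ ℓ₂ => by
    have h₁ := length_code_subst_le τ K hK hτ ℓ₁
    have h₂ := length_code_subst_le τ K hK hτ ℓ₂
    simp only [PropForm.subst, PropForm.code, List.length_cons, List.length_append, PropForm.size,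
      Nat.add_mul, one_mul]
    omega

/-- The values of `substOf` are bindings or `⊤`. [folklore] -/
theorem length_code_substOf_le (vs : List ℕ) (bs : List (PropForm ℕ)) (L : ℕ)
    (hbs : ∀ χ ∈ bs, χ.code.length ≤ L) (y : ℕ) : (substOf vs bs y).code.length ≤ L + 3 := by
  unfold substOf
  split_ifs
  · rw [List.getD_eq_getElem?_getD]
    cases h : bs[vs.idxOf y]? with
    | none => simp [PropForm.code]
    | some χ => simpa using (hbs χ (List.mem_of_getElem? h)).trans (Nat.le_add_right _ _)
  · simp [PropForm.code]

/-- A code word is at most thrice its prefix code (plus the separator). [folklore] -/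
theorem length_encode_le_code (ψ : PropForm ℕ) :
    (encodingPropForm.encode ψ).length ≤ 3 * ψ.code.length + 2 := by
  rw [length_encode_propForm]
  have := ψ.size_le_length_code
  omega

/-- **The coded block is linear in the instance**: if the current line and the chosen premises
have codes of length at most `L` and match the rule, the coded block `σ'(D)` has length at most
`24 · proofSize D · (L + 1)` (the bounds `c₁`, `c₂` of the printed proof). [cite: CookReckhow1979, Thm. 2.3 (proof)] -/
theorem length_encList_block_le (r : FregeRule) (θ : PropForm ℕ) (ℓs : List (PropForm ℕ)) (L : ℕ)
    (hθ : θ.code.length ≤ L) (hℓs : ∀ ℓ ∈ ℓs, ℓ.code.length ≤ L)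
    (hok : matchOkM r θ.code (preOf (ℓs.map PropForm.code)) = true) :
    ∀ D : List (PropForm ℕ),
      (encList (D.map fun ℓ => encodingPropForm.encode (ℓ.subst (σOf r θ ℓs)))).length ≤
        24 * proofSize D * (L + 1) := by
  -- every value of the matching substitution has code length `≤ L + 3`
  have hfit : fits (rulePat r) (bigConj (θ :: ℓs)) = true := by
    rw [matchOkM, streamM_code, skelM_code_fst] at hok
    simp only [Bool.and_eq_true] at hok
    exact hok.1
  have hb : ∀ χ ∈ binds (rulePat r) (bigConj (θ :: ℓs)), χ.code.length ≤ L :=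
    binds_bigConj_bound L (r.conclusion :: r.premises) (θ :: ℓs) hfit
      (fun φ hφ => by rcases List.mem_cons.1 hφ with rfl | h <;> [exact hθ; exact hℓs φ h])
  have hτ : ∀ y, ((σOf r θ ℓs) y).code.length ≤ L + 3 := length_code_substOf_le _ _ L hb
  intro D
  induction D with
  | nil => simp
  | cons ℓ D ih =>
    have h1 := length_code_subst_le _ (L + 3) (by omega) hτ ℓ
    have h2 := length_encode_le_code (ℓ.subst (σOf r θ ℓs))
    have hs := ℓ.size_pos
    simp only [List.map_cons, encList_cons, length_boolPair, proofSize, List.sum_cons] at ih ⊢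
    have : 2 * (encodingPropForm.encode (ℓ.subst (σOf r θ ℓs))).length + 2 ≤ 24 * ℓ.size * (L + 1) := by
      nlinarith
    nlinarith

/-- The cap constant of a rule: `24 · proofSize (D r)`. [folklore] -/
def ccOf (D : FregeRule → List (PropForm ℕ)) (r : FregeRule) : ℕ := 24 * proofSize (D r)

/-- The cap constant of the outer loop: the sum of the rule caps. [folklore] -/
def Kof (D : FregeRule → List (PropForm ℕ)) (rs : List FregeRule) : ℕ := (rs.map (ccOf D)).sum

/-- The line-count constant: the total length of the rule derivations. [folklore] -/
def Mof (D : FregeRule → List (PropForm ℕ)) (rs : List FregeRule) : ℕ := (rs.map fun r => (D r).length).sum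

/-- A rule cap is within the outer cap. [folklore] -/
theorem ccOf_le_Kof (D : FregeRule → List (PropForm ℕ)) {rs : List FregeRule} {r : FregeRule} (hr : r ∈ rs) :
    ccOf D r ≤ Kof D rs :=
  List.le_sum_of_mem (List.mem_map_of_mem hr)

/-- A rule derivation is within the line-count constant. [folklore] -/
theorem length_le_Mof (D : FregeRule → List (PropForm ℕ)) {rs : List FregeRule} {r : FregeRule} (hr : r ∈ rs) :
    (D r).length ≤ Mof D rs :=
  List.le_sum_of_mem (List.mem_map_of_mem (f := fun r => (D r).length) hr)

/-- A block has at most `Mof` lines. [folklore] -/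
theorem length_lineForms_le (D : FregeRule → List (PropForm ℕ)) (rs : List FregeRule) (Es : List (PropForm ℕ))
    (θ : PropForm ℕ) : (lineForms D rs Es θ).length ≤ Mof D rs := by
  rcases lineForms_cases D rs Es θ with h | ⟨r, hr, σ, -, -, h⟩
  · rw [h]; exact Nat.zero_le _
  · rw [h, List.length_map]; exact length_le_Mof D hr

/-- The translation has at most `Mof` lines per line. [folklore] -/
theorem length_translForms_le (D : FregeRule → List (PropForm ℕ)) (rs : List FregeRule) (π : List (PropForm ℕ)) :
    (translForms D rs π).length ≤ π.length * Mof D rs := by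
  induction π using List.reverseRecOn with
  | nil => simp
  | append_singleton π θ ih =>
    rw [translForms_append_singleton, List.length_append, List.length_append, List.length_singleton,
      Nat.succ_mul]
    exact Nat.add_le_add ih (length_lineForms_le D rs π θ)

/-! ### The translation computes `translForms` on code words -/

/-- The list code of `Encoding.listBool` in terms of `encList`. [folklore] -/
theorem listBool_encode_eq (π : List (PropForm ℕ)) :
    encodingPropForm.listBool.encode π =
      boolPair (List.replicate π.length true) (encList (π.map encodingPropForm.encode)) := by
  have h : ∀ l : List (PropForm ℕ),
      l.foldr (fun a acc => boolPair (encodingPropForm.encode a) acc) [] = encList (l.map encodingPropForm.encode) := by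
    intro l; induction l with
    | nil => rfl
    | cons a l ih => simp [encList, ih]
  simp [Computability.Encoding.listBool, OracleCompose.unaryEncodeNat_eq_replicate, h]

/-- Every line of `π` has a prefix code shorter than the list code of `π`. [folklore] -/
theorem length_code_le_length_encode_of_mem {π : List (PropForm ℕ)} {φ : PropForm ℕ} (h : φ ∈ π) :
    φ.code.length ≤ (encodingPropForm.listBool.encode π).length := by
  rw [length_encode_listBool]
  have h1 : 2 * (encodingPropForm.encode φ).length + 2 ≤
      (π.map fun a => 2 * (encodingPropForm.encode a).length + 2).sum :=
    List.le_sum_of_mem (List.mem_map_of_mem (f := fun a => 2 * (encodingPropForm.encode a).length + 2) h)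
  have h2 := length_encode_propForm φ
  omega

/-- The number of lines is less than the length of the list code. [folklore] -/
theorem length_le_length_encode (π : List (PropForm ℕ)) :
    π.length ≤ (encodingPropForm.listBool.encode π).length := by
  rw [length_encode_listBool]; omega

/-- On the values produced, coded and formula-level blocks agree: a comparison lemma for
`findSome?`. [folklore] -/
theorem findSome?_congr_map {α β γ : Type} (G : α → Option β) (f : α → β → γ) (g : α → β → List (PropForm ℕ))
    (H : List (PropForm ℕ) → γ) :
    ∀ l : List α, (∀ a ∈ l, ∀ b, G a = some b → f a b = H (g a b)) →
      l.findSome? (fun a => (G a).map (f a)) = (l.findSome? fun a => (G a).map (g a)).map H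
  | [], _ => rfl
  | a :: l, h => by
    rw [List.findSome?_cons, List.findSome?_cons]
    cases hG : G a with
    | some b => simp [h a (by simp) b hG]
    | none => simpa using findSome?_congr_map G f g H l (fun a' ha' => h a' (by simp [ha']))

/-- The outer state `⟨coded earlier lines, coded output⟩`. [folklore] -/
def stOf (π₁ outs : List (PropForm ℕ)) : List Bool :=
  boolPair (encList (π₁.map PropForm.code)) (encList (outs.map encodingPropForm.encode))

/-- **One step of the outer loop on genuine data**: the earlier lines gain `θ`, the output gains
the block of `θ`. [folklore] -/
theorem outBody_stOf (D : FregeRule → List (PropForm ℕ)) (rs : List FregeRule) (z : List Bool)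
    (π₁ outs : List (PropForm ℕ)) (θ : PropForm ℕ) (hπ₁ : π₁.length ≤ z.length)
    (hL : ∀ φ ∈ θ :: π₁, φ.code.length ≤ z.length) :
    outBody D (ccOf D) rs (Kof D rs) (boolPair z (boolPair (encodingPropForm.encode θ) (stOf π₁ outs))) =
      stOf (π₁ ++ [θ]) (outs ++ lineForms D rs π₁ θ) := by
  rw [stOf, outBody_rec]
  have hθ : sndF (encodingPropForm.encode θ) = θ.code := by simp [encodingPropForm, sndF]
  rw [hθ, (cascS_spec D (ccOf D) z π₁ hπ₁ θ rs).2]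
  -- the coded cascade value is the coded block of `lineForms`
  have hval : (specCasc D (ccOf D) rs z π₁ θ).getD [] =
      encList ((lineForms D rs π₁ θ).map encodingPropForm.encode) := by
    unfold specCasc specR lineForms
    simp only [specSearch_mOf]
    rw [findSome?_congr_map (fun r => tupleSearch r π₁ r.premises θ [])
      (fun r ℓs' => (matchBlkM r (D r) θ.code (preOf (ℓs'.map PropForm.code))).take (ccOf D r * (z.length + 1)))
      (fun r ℓs => (D r).map (PropForm.subst (σOf r θ ℓs)))
      (fun B => encList (B.map encodingPropForm.encode)) rs ?_]
    · cases rs.findSome? (fun r => (tupleSearch r π₁ r.premises θ []).map fun ℓs =>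
          (D r).map (PropForm.subst (σOf r θ ℓs))) <;> simp
    · intro r _ ℓs hfound
      obtain ⟨tail, htl, htail, hok⟩ := tupleSearch_sound r π₁ r.premises θ [] ℓs hfound
      simp only [List.nil_append] at htl
      subst htl
      obtain ⟨-, -, hblk⟩ := matchOkM_sound hok (D r)
      rw [hblk, List.map_map]
      refine List.take_of_length_le ?_
      have := length_encList_block_le r θ ℓs z.length (hL θ (by simp))
        (fun ℓ hℓ => hL ℓ (by simp [htail ℓ hℓ])) hok (D r)
      simpa [ccOf, σOf, Function.comp_def] using this
  -- the coded block is within the outer cap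
  have hbnd : ((specCasc D (ccOf D) rs z π₁ θ).getD []).length ≤ Kof D rs * (z.length + 1) := by
    cases hc : specCasc D (ccOf D) rs z π₁ θ with
    | none => simp
    | some b =>
      obtain ⟨r, hr, hb⟩ := exists_of_findSome?_eq_some hc
      have h1 := length_specSearch_le (length_mOf_le r (D r) (ccOf D r)) z π₁ r.premises θ [] b hb
      exact h1.trans (Nat.mul_le_mul_right _ (ccOf_le_Kof D hr))
  rw [hval] at hbnd ⊢
  rw [stOf, List.map_append, List.map_append, encList_append, encList_append, List.take_of_length_le hbnd]
  simp [encList]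

/-- **The outer loop on genuine data**: folding the body over the code words of `π₂` after
`π₁` extends the earlier lines and the output as `translForms` prescribes. [folklore] -/
theorem foldl_outBody (D : FregeRule → List (PropForm ℕ)) (rs : List FregeRule) (z : List Bool) :
    ∀ (π₂ π₁ : List (PropForm ℕ)), (π₁ ++ π₂).length ≤ z.length →
      (∀ φ ∈ π₁ ++ π₂, φ.code.length ≤ z.length) →
        (π₂.map encodingPropForm.encode).foldl
            (fun st a => outBody D (ccOf D) rs (Kof D rs) (boolPair z (boolPair a st)))
            (stOf π₁ (translForms D rs π₁)) =
          stOf (π₁ ++ π₂) (translForms D rs (π₁ ++ π₂))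
  | [], π₁, _, _ => by simp
  | θ :: π₂, π₁, hlen, hL => by
    rw [List.map_cons, List.foldl_cons, outBody_stOf D rs z π₁ _ θ
      (by rw [List.length_append] at hlen; omega)
      (fun φ hφ => hL φ (by rcases List.mem_cons.1 hφ with rfl | h <;> simp [*])),
      ← translForms_append_singleton,
      foldl_outBody D rs z π₂ (π₁ ++ [θ]) (by simpa using hlen) (fun φ hφ => hL φ (by simpa using hφ))]
    simp

/-- The counting loop counts. [folklore] -/
theorem foldl_lenG (z : List Bool) : ∀ (l : List (List Bool)) (st : List Bool),
    l.foldl (fun st a => lenG (boolPair z (boolPair a st))) st = List.replicate l.length true ++ st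
  | [], st => rfl
  | a :: l, st => by
    rw [List.foldl_cons, show lenG (boolPair z (boolPair a st)) = true :: st by simp [lenG],
      foldl_lenG z l, List.length_cons, replicate_true_append_true_cons]

/-- The initial record on a list code. [folklore] -/
theorem trInit_encode (D : FregeRule → List (PropForm ℕ)) (rs : List FregeRule) (π : List (PropForm ℕ)) :
    trInit (encodingPropForm.listBool.encode π) =
      boolPair (encodingPropForm.listBool.encode π)
        (boolPair (encList (π.map encodingPropForm.encode)) (stOf [] (translForms D rs []))) := by
  have hsnd : sndF (encodingPropForm.listBool.encode π) = encList (π.map encodingPropForm.encode) := by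
    rw [listBool_encode_eq]; exact sndF_boolPair _ _
  rw [trInit, fanoutFn_apply, fanoutFn_apply, hsnd]
  rfl

/-- The outer loop on a list code. [folklore] -/
theorem outerLoop_encode (D : FregeRule → List (PropForm ℕ)) (rs : List FregeRule) (π : List (PropForm ℕ)) :
    feLoop Polynomial.X (outBody D (ccOf D) rs (Kof D rs)) (trInit (encodingPropForm.listBool.encode π)) =
      boolPair (encodingPropForm.listBool.encode π) (boolPair [] (stOf π (translForms D rs π))) := by
  have hπz := length_le_length_encode π
  rw [trInit_encode D rs, feLoop_rec _ _ _ _ _ (by simpa using hπz),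
    foldl_outBody D rs _ π [] (by simpa using hπz)
      (fun φ hφ => length_code_le_length_encode_of_mem (by simpa using hφ))]
  rfl

/-- The final packaging of an outer record. [folklore] -/
theorem trFinal_stOf (M : ℕ) (z : List Bool) (π₁ T : List (PropForm ℕ)) (hT : T.length ≤ M * z.length) :
    trFinal M (boolPair z (boolPair [] (stOf π₁ T))) = encodingPropForm.listBool.encode T := by
  have hT' : (T.map encodingPropForm.encode).length ≤ (Polynomial.C M * Polynomial.X).eval z.length := by
    simpa using hT
  rw [trFinal, fanoutFn_apply, listBool_encode_eq T]
  simp only [Function.comp_apply, stOf, sndPow_succ_boolPair, sndPow_zero_boolPair, fstF_boolPair,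
    fanoutFn_apply]
  rw [feLoop_rec _ _ _ _ _ hT', foldl_lenG]
  simp

/-- **The translation computes `translForms` on code words.** [cite: CookReckhow1979, Thm. 2.3] -/
theorem translS_encode (D : FregeRule → List (PropForm ℕ)) (rs : List FregeRule) (π : List (PropForm ℕ)) :
    translS D (ccOf D) rs (Kof D rs) (Mof D rs) (encodingPropForm.listBool.encode π) =
      encodingPropForm.listBool.encode (translForms D rs π) := by
  have hT : (translForms D rs π).length ≤ Mof D rs * (encodingPropForm.listBool.encode π).length :=
    calc (translForms D rs π).length ≤ π.length * Mof D rs := length_translForms_le D rs π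
      _ ≤ (encodingPropForm.listBool.encode π).length * Mof D rs :=
          Nat.mul_le_mul_right _ (length_le_length_encode π)
      _ = _ := Nat.mul_comm _ _
  rw [translS, Function.comp_apply, Function.comp_apply, outerLoop_encode D rs π, trFinal_stOf _ _ _ _ hT]

/-! ### Polynomial-time computability of the formula-level translation -/

/-- **The translation function** of the rule list `rs` with the table of derivations `D` (the
`f ∈ 𝓛` of the theorem, with its constants fixed). [cite: CookReckhow1979, Thm. 2.3] -/
noncomputable def translFn (D : FregeRule → List (PropForm ℕ)) (rs : List FregeRule) : List Bool → List Bool :=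
  translS D (ccOf D) rs (Kof D rs) (Mof D rs)

/-- **`translFn ∈ FP`** ("there is a function `f` in `𝓛`"). [cite: CookReckhow1979, Thm. 2.3] -/
theorem translFn_mem_FP (D : FregeRule → List (PropForm ℕ)) (rs : List FregeRule) : translFn D rs ∈ FP :=
  translS_mem_FP _ _ _ _ _

/-- **`translFn` computes `translForms` on code words.** [cite: CookReckhow1979, Thm. 2.3] -/
theorem translFn_encode (D : FregeRule → List (PropForm ℕ)) (rs : List FregeRule) (π : List (PropForm ℕ)) :
    translFn D rs (encodingPropForm.listBool.encode π) = encodingPropForm.listBool.encode (translForms D rs π) :=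
  translS_encode D rs π

/-- **The formula-level translation `translForms D rs` is polynomial-time computable** with respect
to the list code of formulas (`encodingPropForm.listBool`), on Mathlib's `TM2` model — the first
conjunct of `FregeSystem.PSimulates` (by `PolyTimeComputable.of_encode` from `translFn ∈ FP`).
[cite: CookReckhow1979, Thm. 2.3] -/
theorem polyTimeComputable_translForms (D : FregeRule → List (PropForm ℕ)) (rs : List FregeRule) :
    PolyTimeComputable encodingPropForm.listBool.encode encodingPropForm.listBool.encode (translForms D rs) :=
  (translFn_mem_FP D rs).of_encode _ (fun _ => rfl) (translFn_encode D rs)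


end FregeTransl

end Literature.Computability.MetaComplexity
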